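import Mathlib.FieldTheory.Fixed
import Literature.NumberTheory.EllipticCurves.Kato2004.IwasawaH1ReductionInfty
import Literature.NumberTheory.EllipticCurves.Sha
import Literature.NumberTheory.EllipticCurves.IwasawaSelmerControlLocalInputsProofs
import Literature.NumberTheory.EllipticCurves.Greenberg1999.ControlLocalKernelAtPMultiplicative
import Literature.NumberTheory.EllipticCurves.TateCurve.NumberFieldUniformization
import Literature.NumberTheory.EllipticCurves.PAdicBSDSplitMultiplicativeProofs
import Literature.NumberTheory.EllipticCurves.SelmerCorankControlRatProofs
import Literature.NumberTheory.EllipticCurves.Greenberg1999.LocalCyclotomicTowerLayerProofs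
import HarnessLib

/-!
# `sec3_natCard_pTorsion_localTowerKerPrimary_le_splitMultiplicative_rat` HOLDS — the `p`-torsion of the local cyclotomic-tower kernel at a split multiplicative prime has order `≤ p` (Greenberg 1999 §3; re-homed proofs, file 2 of 2)

Family `bsd` material RE-HOMED into `Literature/` by the Hodge foundations lane (`lit-hodgefound`, seat p20, generation 35):
file 2 of 2:
verbatim ports, in dependency order and each with its original module docstring (Parts 1–5), of the cell `bsd-2adic` TOWER-road
modules `Summits/BirchSwinnertonDyer/BirchSwinnertonDyer/Theorems/ByReductionTypeAtTwoMultTower{NS2TwistedTateAlgebra, SplitTowerAlgebra,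
NS2TateTransport, NS2TorsionEmbedding, SplitOneBitHolds}.lean` (the lower seven modules of the cone are file 1 of 2,
`LocalCyclotomicTowerLayerProofs`, imported) (route `ByReductionTypeAtTwo`, crux
`MultUpperHalfAtTwo`, item stmt-BirchSwinnertonDyer-19922), namespaces re-rooted
`Summit.BirchSwinnertonDyer.BirchSwinnertonDyer.Theorems.{MultTowerNS2, MultTowerSP1}` ↦
`Literature.NumberTheory.EllipticCurves.Greenberg1999.{MultTowerNS2, MultTowerSP1}`; theorems only (no definition, no named fact),
imports Literature/Mathlib only; all `[folklore]` helpers privatised (Part 0 re-proves privately the two one-line `[folklore]` helpers of file 1 that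
Parts 1–2 use, `MultTowerNS2.localSubgroup_layerSubgroup_succ_le` and `MultTowerNS2.isOpen_localSubgroup`, private there); `open`
commands made `_root_`-explicit.  CONTENT (Greenberg, LNM 1716, §3 pp. 85–93, made explicit on the Tate module): the local cyclotomic
`ℤ_p`-tower at a prime `v ∋ p` of a number field — layer indices and layer fields, the cyclotomic action and topological
generators `g ∈ H_n` of `H_n / H_∞`, `2`-adic units, layer norm groups and tower cosets, the twisted Tate algebra (orbit
products `N_R`, cyclic Hilbert 90 one layer up), the SPLIT tower algebra, Tate transport through Tate's split uniformisation
`Φ : K̄_vˣ → E(K̄_v)` (the tree THEOREM `TateCurve.Silverman1994_thmV53_tateUniformisation_holds`), the torsion embedding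
`𝒦_{v,n}[p^∞][p] ↪ (M_∞/(g−1)M_∞)[p]`, and the pigeonhole conclusion.  WHY: Part 5 is the only proof in the tree of the
Literature named fact `NumberTheory.EllipticCurves.Greenberg1999.sec3_natCard_pTorsion_localTowerKerPrimary_le_splitMultiplicative_rat`
(Greenberg 1999 §3 pp. 91–92: for `W/ℚ` globally minimal and split multiplicative at `p`, the `p`-torsion of the `p`-primary
local tower kernel `𝒦_{v,n}` is finite of order `≤ p`), which `Literature/` could not import; Part 6 restates that discharge
under its FULLY-QUALIFIED name of record.  Summits-side twin:
`Summit.BirchSwinnertonDyer.BirchSwinnertonDyer.Theorems.MultTowerSP1.sec3_natCard_pTorsion_localTowerKerPrimary_le_splitMultiplicative_rat_holds`.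
The Summits originals stay in place (transitional duplication; cited here).  Honest framing of the originals stands: the
fact is a HYPOTHESIS binder of split tower class files of item 19922; nothing is booked, BSD is not proved by any of this.
-/

noncomputable section

/-! ## Part 0 — two one-line `[folklore]` helpers of file 1 (`LocalCyclotomicTowerLayerProofs`, private there) -/

section Part0

set_option autoImplicit false

universe u

namespace Literature.NumberTheory.EllipticCurves.Greenberg1999.MultTowerNS2

open _root_.NumberField _root_.Field _root_.Literature.NumberTheory.EllipticCurves
  _root_.Literature.NumberTheory.GaloisRepresentations

/-- `H_{n+1} ≤ H_n` for the local layer subgroups. [folklore] -/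
private theorem localSubgroup_layerSubgroup_succ_le {p : ℕ} [Fact p.Prime] {κ : ZpExtension ℚ p}
    (v : IsDedekindDomain.HeightOneSpectrum (𝓞 ℚ)) (n : ℕ) :
    localSubgroup (κ.layerSubgroup (n + 1)) (v.adicCompletion ℚ) ≤
      localSubgroup (κ.layerSubgroup n) (v.adicCompletion ℚ) :=
  Subgroup.comap_mono (κ.layerSubgroup_antitone (Nat.le_succ n))

/-- `localSubgroup H E = res⁻¹(H)` is open in `Γ_E` when `H` is open in `Γ_K` (the restriction `resGal E` is
continuous). [folklore] -/
private theorem isOpen_localSubgroup {K : Type u} [Field K] (H : Subgroup (absoluteGaloisGroup K))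
    (hH : IsOpen (H : Set (absoluteGaloisGroup K))) (E : Type u) [Field E] [Algebra K E] :
    IsOpen (localSubgroup H E : Set (absoluteGaloisGroup E)) :=
  hH.preimage (resGal (K := K) E).continuous_toFun

end Literature.NumberTheory.EllipticCurves.Greenberg1999.MultTowerNS2

end Part0

/-!
## Part 1 — port of `Summits/BirchSwinnertonDyer/BirchSwinnertonDyer/Theorems/ByReductionTypeAtTwoMultTowerNS2TwistedTateAlgebra.lean`

# Route `ByReductionTypeAtTwo`, crux `MultUpperHalfAtTwo` (item stmt-BirchSwinnertonDyer-19922), TOWER road, the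
# «ONE BIT AT A NON-SPLIT 2» rows: KERNEL BRICK 16a — algebra of the twisted Tate module over the local cyclotomic
# `ℤ₂`-tower: flips, `Γ`-stability of the fixed fields `K̄^{H ∩ Stab(t)}`, orbit products, and the two Hilbert 90's

HONEST FRAMING (cell `bsd-2adic`, run/shared/lean/pub/bsd-2adic/, seat `bsd-2adic-tower-1` GEN 9, HUMAN RULINGS
D-0036 / D-0054 / D-0074): TOOL theorems only (no definition, no named fact, no `sorry`); closes nothing by itself;
nothing booked; BSD is not proved by any of this. Module M6 (steps S3–S6) of the KERNELISATION of the MEMO binder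
`MultTowerNS2.localTowerKerTwoTorsion_le_two_nonsplitTwo_of_tateUnit` (scope memo HOME/tower/SCOPE-hNS2one-kernel-GEN8.md).
Setting (`v ∋ 2`, `K = ℚ_v`, `Γ = Gal(K̄/K)` acting on `K̄`): an element `t ∈ K̄` with `σ t = ±t` for all `σ` (the
square root `√γ` of the twisted Tate uniformisation), a normal subgroup `N ≤ Γ` (a local layer subgroup `H_m`), the
subgroup `N ∩ Stab(t)` and its fixed field `K̄^{N ∩ Stab(t)}` (the compositum `F_m K(t)`), a «flip» `τ₀` (`τ₀ t = −t`).

* `smul_mem_fixedField_inf_stabilizer` — `K̄^{N ∩ Stab(t)}` is `Γ`-stable; `flip_smul_eq` — two flips of `N` agree on it;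
* `prod_smul_*` — the orbit products `N_R(w) = ∏_{i<2^R} g^i w` (multiplicativity, shift by `g`, `N_{R+1} = N_R · g^{2^R}N_R`);
* `eq_flip_smul_div_of_flip_smul_mul_eq_one` — **quadratic Hilbert 90, explicit**: `τ₀z · z = 1 ⇒ z = τ₀(z₀)/z₀` with
  `z₀ = 1 + z⁻¹` or `z₀ = t`;
* `exists_eq_smul_div_of_prod_smul_eq_one` — **cyclic Hilbert 90 for `⟨g⟩` on `K̄^{H_{n+R} ∩ Stab(t)}`**: `N_R(u) = 1 ⇒
  u = g(y)/y` (Artin's independence of the characters `x ↦ g^i x`, Mathlib `linearIndependent_monoidHom`; the Lagrange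
  resolvent `θ = ∑ (∏_{j<i} g^j u) g^i b` has `u · gθ = θ`).

References: J. Neukirch, *ANT* IV (3.5) (Hilbert 90), E. Artin (independence of characters); scope memo S4/S6.
-/

section Part1

set_option autoImplicit false

open scoped _root_.Classical _root_.IntermediateField

namespace Literature.NumberTheory.EllipticCurves.Greenberg1999.MultTowerNS2

open _root_.NumberField _root_.IsDedekindDomain _root_.Field _root_.PadicInt _root_.Literature.NumberTheory.EllipticCurves
  _root_.Literature.NumberTheory.GaloisRepresentations

variable {K : Type*} [Field K]

/-! ### Flips and the `Γ`-stability of `K̄^{N ∩ Stab(t)}` -/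

/-- If `σ t = ±t` then `σ⁻¹ t = σ t` (both signs square to `1`). [folklore] -/
private theorem inv_smul_eq_smul_of_smul_eq_or {t : AlgebraicClosure K} {σ : absoluteGaloisGroup K}
    (h : σ • t = t ∨ σ • t = -t) : σ⁻¹ • t = σ • t := by
  rcases h with h | h
  · rw [h]; nth_rw 1 [← h]; rw [inv_smul_smul]
  · rw [h]
    have h' : σ⁻¹ • (σ • t) = t := inv_smul_smul σ t
    rw [h, smul_neg, neg_eq_iff_eq_neg] at h'
    exact h'

/-- A conjugate `σ⁻¹ h σ` of an element `h` fixing `t` fixes `t` (when every element maps `t` to `±t`). [folklore] -/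
private theorem conj_smul_eq_of_smul_eq {t : AlgebraicClosure K} (ht : ∀ σ : absoluteGaloisGroup K, σ • t = t ∨ σ • t = -t)
    {h : absoluteGaloisGroup K} (hh : h • t = t) (σ : absoluteGaloisGroup K) : (σ⁻¹ * h * σ) • t = t := by
  rw [mul_smul, mul_smul]
  rcases ht σ with hs | hs
  · rw [hs, hh, inv_smul_eq_smul_of_smul_eq_or (ht σ), hs]
  · rw [hs, smul_neg, hh, smul_neg, inv_smul_eq_smul_of_smul_eq_or (ht σ), hs, neg_neg]

/-- **`K̄^{N ∩ Stab(t)}` is `Γ`-stable** for `N ⊴ Γ` and `σ t = ±t` for all `σ`: if `x` is fixed by every element of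
`N` fixing `t`, so is `σ x`. [folklore] -/
private theorem smul_mem_of_forall_mem_smul_eq {t : AlgebraicClosure K}
    (ht : ∀ σ : absoluteGaloisGroup K, σ • t = t ∨ σ • t = -t) (N : Subgroup (absoluteGaloisGroup K)) [N.Normal]
    {x : AlgebraicClosure K} (hx : ∀ h ∈ N, h • t = t → h • x = x) (σ : absoluteGaloisGroup K) :
    ∀ h ∈ N, h • t = t → h • (σ • x) = σ • x := by
  intro h hh hht
  have hc : σ⁻¹ * h * σ ∈ N := by
    have := Subgroup.Normal.conj_mem inferInstance h hh σ⁻¹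
    rwa [inv_inv] at this
  have h1 := hx _ hc (conj_smul_eq_of_smul_eq ht hht σ)
  rw [mul_smul, mul_smul, inv_smul_eq_iff] at h1
  exact h1

/-- **Two flips of `N` agree on `K̄^{N ∩ Stab(t)}`**: if `τ₀, τ ∈ N` both send `t ↦ −t` and `x` is fixed by
`N ∩ Stab(t)`, then `τ x = τ₀ x`. [folklore] -/
private theorem flip_smul_eq {t : AlgebraicClosure K} {N : Subgroup (absoluteGaloisGroup K)} {τ₀ τ : absoluteGaloisGroup K}
    (hτ₀ : τ₀ ∈ N) (hτ₀t : τ₀ • t = -t) (hτ : τ ∈ N) (hτt : τ • t = -t) {x : AlgebraicClosure K}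
    (hx : ∀ h ∈ N, h • t = t → h • x = x) : τ • x = τ₀ • x := by
  have h1 : (τ₀⁻¹ * τ) • t = t := by
    rw [mul_smul, hτt, smul_neg, inv_smul_eq_smul_of_smul_eq_or (Or.inr hτ₀t), hτ₀t, neg_neg]
  have h2 := hx _ (N.mul_mem (N.inv_mem hτ₀) hτ) h1
  rw [mul_smul, inv_smul_eq_iff] at h2
  exact h2

/-- **`τ₀ (σ x) = σ (τ₀ x)`** for `σ` fixing `t`, a flip `τ₀ ∈ N ⊴ Γ` and `x ∈ K̄^{N ∩ Stab(t)}` (the conjugate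
`σ⁻¹ τ₀ σ` is again a flip of `N`). [folklore] -/
private theorem flip_smul_smul_comm {t : AlgebraicClosure K} (ht : ∀ σ : absoluteGaloisGroup K, σ • t = t ∨ σ • t = -t)
    {N : Subgroup (absoluteGaloisGroup K)} [N.Normal] {τ₀ : absoluteGaloisGroup K} (hτ₀ : τ₀ ∈ N) (hτ₀t : τ₀ • t = -t)
    {σ : absoluteGaloisGroup K} (hσ : σ • t = t) {x : AlgebraicClosure K} (hx : ∀ h ∈ N, h • t = t → h • x = x) :
    τ₀ • (σ • x) = σ • (τ₀ • x) := by
  have hc : σ⁻¹ * τ₀ * σ ∈ N := by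
    have := Subgroup.Normal.conj_mem inferInstance τ₀ hτ₀ σ⁻¹
    rwa [inv_inv] at this
  have hct : (σ⁻¹ * τ₀ * σ) • t = -t := by
    rw [mul_smul, mul_smul, hσ, hτ₀t, smul_neg, inv_smul_eq_smul_of_smul_eq_or (ht σ), hσ]
  have h := flip_smul_eq hτ₀ hτ₀t hc hct hx
  rw [mul_smul, mul_smul, inv_smul_eq_iff] at h
  exact h

/-- `τ₀² x = x` for a flip `τ₀ ∈ N` and `x ∈ K̄^{N ∩ Stab(t)}`. [folklore] -/
private theorem flip_smul_flip_smul {t : AlgebraicClosure K} {N : Subgroup (absoluteGaloisGroup K)} {τ₀ : absoluteGaloisGroup K}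
    (hτ₀ : τ₀ ∈ N) (hτ₀t : τ₀ • t = -t) {x : AlgebraicClosure K} (hx : ∀ h ∈ N, h • t = t → h • x = x) :
    τ₀ • (τ₀ • x) = x := by
  rw [← mul_smul]
  exact hx _ (N.mul_mem hτ₀ hτ₀) (by rw [mul_smul, hτ₀t, smul_neg, hτ₀t, neg_neg])

/-- A smaller subgroup fixes more: `x ∈ K̄^{N ∩ Stab(t)}` and `N' ≤ N` give `x ∈ K̄^{N' ∩ Stab(t)}`. [folklore] -/
private theorem forall_mem_smul_eq_of_le {t : AlgebraicClosure K} {N N' : Subgroup (absoluteGaloisGroup K)} (hle : N' ≤ N)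
    {x : AlgebraicClosure K} (hx : ∀ h ∈ N, h • t = t → h • x = x) : ∀ h ∈ N', h • t = t → h • x = x :=
  fun h hh hht ↦ hx h (hle hh) hht

/-! ### Orbit products `N_R(w) = ∏_{i<2^R} g^i w` -/

/-- `N(w₁ w₂) = N(w₁) N(w₂)`. [folklore] -/
private theorem prod_smul_mul (g : absoluteGaloisGroup K) (m : ℕ) (w₁ w₂ : AlgebraicClosure K) :
    (∏ i ∈ Finset.range m, (g ^ i) • (w₁ * w₂)) =
      (∏ i ∈ Finset.range m, (g ^ i) • w₁) * ∏ i ∈ Finset.range m, (g ^ i) • w₂ := by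
  rw [← Finset.prod_mul_distrib]
  exact Finset.prod_congr rfl fun i _ ↦ smul_mul' _ _ _

/-- `N(w⁻¹) = N(w)⁻¹`. [folklore] -/
private theorem prod_smul_inv (g : absoluteGaloisGroup K) (m : ℕ) (w : AlgebraicClosure K) :
    (∏ i ∈ Finset.range m, (g ^ i) • w⁻¹) = (∏ i ∈ Finset.range m, (g ^ i) • w)⁻¹ := by
  rw [← Finset.prod_inv_distrib]
  exact Finset.prod_congr rfl fun i _ ↦ smul_inv'' _ _

/-- `N_m(g w) = N_m(w)` when `g^m w = w`. [folklore] -/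
private theorem prod_smul_smul_eq (g : absoluteGaloisGroup K) (m : ℕ) {w : AlgebraicClosure K} (hw : (g ^ m) • w = w) :
    (∏ i ∈ Finset.range m, (g ^ i) • (g • w)) = ∏ i ∈ Finset.range m, (g ^ i) • w := by
  have h : ∀ i, (g ^ i) • (g • w) = (g ^ (i + 1)) • w := fun i ↦ by rw [← mul_smul, ← pow_succ]
  simp_rw [h]
  by_cases hw0 : w = 0
  · simp [hw0]
  -- `(∏_{i<m} g^{i+1} w) · g^0 w = ∏_{i<m+1} g^i w = (∏_{i<m} g^i w) · g^m w`
  have h1 := Finset.prod_range_succ' (fun i ↦ (g ^ i) • w) m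
  rw [Finset.prod_range_succ, hw, pow_zero, one_smul] at h1
  exact mul_right_cancel₀ hw0 h1.symm

/-- `g^m N_m(w) = N_m(w)` when `g^m w = w`. [folklore] -/
private theorem pow_smul_prod_smul_eq (g : absoluteGaloisGroup K) (m : ℕ) {w : AlgebraicClosure K} (hw : (g ^ m) • w = w) :
    (g ^ m) • (∏ i ∈ Finset.range m, (g ^ i) • w) = ∏ i ∈ Finset.range m, (g ^ i) • w := by
  rw [Finset.smul_prod']
  refine Finset.prod_congr rfl fun i _ ↦ ?_
  rw [← mul_smul, ← pow_add, add_comm, pow_add, mul_smul, hw]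

/-- `N_{2m}(w) = N_m(w) · g^m N_m(w)` (splitting the range `[0, 2m)`). [folklore] -/
private theorem prod_smul_range_two_mul (g : absoluteGaloisGroup K) (m : ℕ) (w : AlgebraicClosure K) :
    (∏ i ∈ Finset.range (2 * m), (g ^ i) • w) =
      (∏ i ∈ Finset.range m, (g ^ i) • w) * (g ^ m) • ∏ i ∈ Finset.range m, (g ^ i) • w := by
  rw [two_mul, Finset.prod_range_add, Finset.smul_prod']
  congr 1
  exact Finset.prod_congr rfl fun i _ ↦ by rw [pow_add, mul_smul]

/-- `N_m` of a `g`-fixed element is its `m`-th power. [folklore] -/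
private theorem prod_smul_eq_pow_of_smul_eq (g : absoluteGaloisGroup K) (m : ℕ) {w : AlgebraicClosure K} (hw : g • w = w) :
    (∏ i ∈ Finset.range m, (g ^ i) • w) = w ^ m := by
  have h : ∀ i, (g ^ i) • w = w := fun i ↦ by
    induction i with
    | zero => rw [pow_zero, one_smul]
    | succ i ih => rw [pow_succ, mul_smul, hw, ih]
  simp_rw [h]
  rw [Finset.prod_const, Finset.card_range]

/-! ### Quadratic Hilbert 90, explicit -/

/-- **Quadratic Hilbert 90, explicit.** If `τ₀ z · z = 1` (`z ≠ 0`) then `z = τ₀(z₀)/z₀` with `z₀ = 1 + z⁻¹` (when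
`1 + z⁻¹ ≠ 0`) — and when `z = −1`, `z = τ₀(t)/t` for any `t ≠ 0` with `τ₀ t = −t`. [cite: NeukirchANT1999, Ch. IV (3.5)] -/
theorem eq_flip_smul_div_of_flip_smul_mul_eq_one (τ₀ : absoluteGaloisGroup K) {z : AlgebraicClosure K} (hz : z ≠ 0)
    (hz1 : τ₀ • z * z = 1) :
    (1 + z⁻¹ ≠ 0 → z = τ₀ • (1 + z⁻¹) / (1 + z⁻¹)) ∧
      (1 + z⁻¹ = 0 → ∀ t : AlgebraicClosure K, t ≠ 0 → τ₀ • t = -t → z = τ₀ • t / t) := by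
  have hτz : τ₀ • z = z⁻¹ := eq_inv_of_mul_eq_one_left hz1
  constructor
  · intro h0
    rw [smul_add, smul_one, smul_inv'', hτz, inv_inv, eq_div_iff h0]
    field_simp
    ring
  · intro h0 t ht0 hτt
    have hz' : z = -1 := by
      have h1 : z * (1 + z⁻¹) = 0 := by rw [h0, mul_zero]
      rw [mul_add, mul_one, mul_inv_cancel₀ hz] at h1
      linear_combination h1
    rw [hz', hτt, neg_div, div_self ht0]

/-! ### Cyclic Hilbert 90 for `⟨g⟩` acting on `K̄^{H_{n+R} ∩ Stab(t)}` -/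

variable {κ : ZpExtension ℚ 2}

/-- **Cyclic Hilbert 90 for the local layer.** `κ` the cyclotomic `ℤ₂`-extension, `v ∋ 2`, `g ∈ Γ_{ℚ_v}` with
`κ(res g) = 2^n u_g` (`u_g` a unit) fixing `t` (`σ t = ±t` for all `σ`), `M = K̄_v^{H_{n+R} ∩ Stab(t)}`: the group
`⟨g⟩` acts on `M` through a cyclic group of order `2^R`, and an element `u ∈ M` with `∏_{i<2^R} g^i u = 1` is `g(y)/y`
for some `y ∈ Mˣ`. Proof: the `2^R` characters `x ↦ g^i x` of `Mˣ` are distinct (`g^i ∉ H_{n+R} = Gal(K̄/F_{n+R})`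
for `0 < i < 2^R`, BRICK 15), hence linearly independent (Artin; Mathlib `linearIndependent_monoidHom`), so some
Lagrange resolvent `θ = ∑_i (∏_{j<i} g^j u) g^i b` is non-zero; it satisfies `u · gθ = θ`, and `y = θ⁻¹`.
[cite: NeukirchANT1999, Ch. IV (3.5)] -/
theorem exists_eq_smul_div_of_prod_smul_eq_one (v : HeightOneSpectrum (𝓞 ℚ)) (n R : ℕ)
    {g : absoluteGaloisGroup (v.adicCompletion ℚ)} {ug : ℤ_[2]ˣ}
    (hug : ((κ (resGal (K := ℚ) (v.adicCompletion ℚ) g)).toAdd : ℤ_[2]) = 2 ^ n * (ug : ℤ_[2]))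
    {t : AlgebraicClosure (v.adicCompletion ℚ)}
    (ht : ∀ σ : absoluteGaloisGroup (v.adicCompletion ℚ), σ • t = t ∨ σ • t = -t) (hgt : g • t = t)
    {u : AlgebraicClosure (v.adicCompletion ℚ)}
    (hu : ∀ h ∈ localSubgroup (κ.layerSubgroup (n + R)) (v.adicCompletion ℚ), h • t = t → h • u = u)
    (hN : (∏ i ∈ Finset.range (2 ^ R), (g ^ i) • u) = 1) :
    ∃ y : AlgebraicClosure (v.adicCompletion ℚ), y ≠ 0 ∧
      (∀ h ∈ localSubgroup (κ.layerSubgroup (n + R)) (v.adicCompletion ℚ), h • t = t → h • y = y) ∧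
      u = g • y / y := by
  -- the field `M = K̄^{H_{n+R} ∩ Stab(t)}` and the subfield `F_{n+R} = K̄^{H_{n+R}}`
  set Hm := localSubgroup (κ.layerSubgroup (n + R)) (v.adicCompletion ℚ) with hHm
  haveI hnormal : Hm.Normal := by rw [hHm, localSubgroup_eq_comap]; exact Subgroup.Normal.comap inferInstance _
  let M : IntermediateField (v.adicCompletion ℚ) (AlgebraicClosure (v.adicCompletion ℚ)) :=
    IntermediateField.fixedField (Hm ⊓ MulAction.stabilizer (absoluteGaloisGroup (v.adicCompletion ℚ)) t)
  have hmemM : ∀ x, x ∈ M ↔ ∀ h ∈ Hm, h • t = t → h • x = x := by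
    intro x
    rw [IntermediateField.mem_fixedField_iff]
    constructor
    · intro hx h hh hht
      have hmem : h ∈ Hm ⊓ MulAction.stabilizer (absoluteGaloisGroup (v.adicCompletion ℚ)) t :=
        Subgroup.mem_inf.mpr ⟨hh, MulAction.mem_stabilizer_iff.mpr hht⟩
      exact hx h hmem
    · intro hx f hf
      let f' : absoluteGaloisGroup (v.adicCompletion ℚ) := f
      have hf' : f' ∈ Hm ⊓ MulAction.stabilizer (absoluteGaloisGroup (v.adicCompletion ℚ)) t := hf
      obtain ⟨hf1, hf2⟩ := Subgroup.mem_inf.mp hf'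
      exact hx f' hf1 (MulAction.mem_stabilizer_iff.mp hf2)
  have hstab : ∀ σ : absoluteGaloisGroup (v.adicCompletion ℚ), ∀ x ∈ M, σ • x ∈ M := fun σ x hx ↦
    (hmemM _).mpr (smul_mem_of_forall_mem_smul_eq ht Hm ((hmemM x).mp hx) σ)
  have hgit : ∀ i : ℕ, (g ^ i) • t = t := fun i ↦ by
    induction i with
    | zero => rw [pow_zero, one_smul]
    | succ i ih => rw [pow_succ, mul_smul, hgt, ih]
  have hgi : ∀ i : ℕ, g ^ i ∈ Hm ↔ 2 ^ R ∣ i := pow_mem_localSubgroup_layerSubgroup_iff (κ := κ) v n R hug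
  have hgRM : ∀ x ∈ M, (g ^ 2 ^ R) • x = x := fun x hx ↦ (hmemM x).mp hx _ ((hgi _).mpr dvd_rfl) (hgit _)
  have huM : u ∈ M := (hmemM u).mpr hu
  have hopen : IsOpen (Hm : Set (absoluteGaloisGroup (v.adicCompletion ℚ))) :=
    isOpen_localSubgroup _ (κ.isOpen_layerSubgroup (n + R)) _
  have hFM : IntermediateField.fixedField Hm ≤ M := IntermediateField.fixedField_le inf_le_left
  -- `u ≠ 0`
  have hR0 : 0 < 2 ^ R := pow_pos two_pos R
  have hu0 : u ≠ 0 := by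
    intro h0
    have hz : (∏ i ∈ Finset.range (2 ^ R), (g ^ i) • u) = 0 :=
      Finset.prod_eq_zero (Finset.mem_range.mpr hR0) (by rw [h0, smul_zero])
    rw [hz] at hN
    exact zero_ne_one hN
  -- (`CharZero ℚ_v` from here on; no term mentioning `localSubgroup` is written after this point)
  haveI : CharZero (v.adicCompletion ℚ) :=
    charZero_of_injective_algebraMap (algebraMap ℚ (v.adicCompletion ℚ)).injective
  have hfix := fixingSubgroup_fixedField_of_isOpen _ hopen
  have hHfix := fun σ ↦ SetLike.ext_iff.mp hfix σ
  -- the characters `x ↦ g^i x` of `M`, `i < 2^R`, are distinct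
  let χ : Fin (2 ^ R) → (M →* AlgebraicClosure (v.adicCompletion ℚ)) := fun i ↦
    { toFun := fun x ↦ (g ^ (i : ℕ)) • (x : AlgebraicClosure (v.adicCompletion ℚ))
      map_one' := by simp
      map_mul' := fun x y ↦ by
        rw [IntermediateField.coe_mul]
        exact smul_mul' _ _ _ }
  have hχapp : ∀ (i : Fin (2 ^ R)) (x : M), χ i x = (g ^ (i : ℕ)) • (x : AlgebraicClosure (v.adicCompletion ℚ)) :=
    fun _ _ ↦ rfl
  have key : ∀ i i' : Fin (2 ^ R), (i : ℕ) < i' → χ i = χ i' → False := by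
    intro i i' hlt heq
    set d : ℕ := (i' : ℕ) - i with hd
    have hd0 : 0 < d := by omega
    have hdlt : d < 2 ^ R := by omega
    have hgd : g ^ d ∉ Hm := by
      rw [hgi]
      intro hdvd
      exact absurd (Nat.le_of_dvd hd0 hdvd) (by omega)
    -- some `b ∈ F_{n+R}` is moved by `g^d`
    have hnot : ¬ ∀ b : IntermediateField.fixedField Hm,
        (g ^ d) • (b : AlgebraicClosure (v.adicCompletion ℚ)) = b := by
      intro hall
      exact hgd ((hHfix (g ^ d)).mp ((mem_fixingSubgroup_iff_forall_smul (IntermediateField.fixedField Hm) (g ^ d)).mpr hall))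
    push Not at hnot
    obtain ⟨⟨b, hb⟩, hgb⟩ := hnot
    have h1 := DFunLike.congr_fun heq ⟨b, hFM hb⟩
    rw [hχapp, hχapp] at h1
    change (g ^ (i : ℕ)) • b = (g ^ (i' : ℕ)) • b at h1
    rw [show (i' : ℕ) = (i : ℕ) + d by omega, pow_add, mul_smul] at h1
    exact hgb (smul_left_cancel (g ^ (i : ℕ)) h1.symm)
  have hχinj : Function.Injective χ := by
    intro i i' h
    rcases lt_trichotomy (i : ℕ) i' with hlt | heq | hgt
    · exact (key i i' hlt h).elim
    · exact Fin.ext heq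
    · exact (key i' i hgt h.symm).elim
  -- Artin: the characters are linearly independent, so some Lagrange resolvent is non-zero
  have hli := (linearIndependent_monoidHom M (AlgebraicClosure (v.adicCompletion ℚ))).comp χ hχinj
  let c : ℕ → AlgebraicClosure (v.adicCompletion ℚ) := fun i ↦ ∏ j ∈ Finset.range i, (g ^ j) • u
  have hc0 : c 0 = 1 := Finset.prod_range_zero _
  have hcN : c (2 ^ R) = 1 := hN
  obtain ⟨b, hb⟩ : ∃ b : M, (∑ i : Fin (2 ^ R), c i * (g ^ (i : ℕ)) • (b : AlgebraicClosure (v.adicCompletion ℚ))) ≠ 0 := by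
    by_contra hall
    push Not at hall
    have hsum : (∑ i : Fin (2 ^ R), c i • ((χ i : M →* AlgebraicClosure (v.adicCompletion ℚ)) :
        M → AlgebraicClosure (v.adicCompletion ℚ))) = 0 := by
      funext x
      rw [Finset.sum_apply, Pi.zero_apply]
      simp only [Pi.smul_apply, smul_eq_mul]
      exact hall x
    have h0 := Fintype.linearIndependent_iff.mp hli (fun i ↦ c i) hsum ⟨0, hR0⟩
    exact one_ne_zero (hc0 ▸ h0)
  -- the resolvent `θ` and the identity `u · gθ = θ`
  set θ : AlgebraicClosure (v.adicCompletion ℚ) :=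
    ∑ i ∈ Finset.range (2 ^ R), c i * (g ^ i) • (b : AlgebraicClosure (v.adicCompletion ℚ)) with hθ
  have hθb : (∑ i : Fin (2 ^ R), c i * (g ^ (i : ℕ)) • (b : AlgebraicClosure (v.adicCompletion ℚ))) = θ :=
    Fin.sum_univ_eq_sum_range (fun i ↦ c i * (g ^ i) • (b : AlgebraicClosure (v.adicCompletion ℚ))) (2 ^ R)
  have hθ0 : θ ≠ 0 := hθb ▸ hb
  have hshift : ∀ i : ℕ, u * (g • c i) = c (i + 1) := by
    intro i
    change u * (g • ∏ j ∈ Finset.range i, (g ^ j) • u) = ∏ j ∈ Finset.range (i + 1), (g ^ j) • u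
    rw [Finset.prod_range_succ', pow_zero, one_smul, Finset.smul_prod', mul_comm]
    congr 1
    exact Finset.prod_congr rfl fun j _ ↦ by rw [← mul_smul, ← pow_succ']
  have hgb : (g ^ 2 ^ R) • (b : AlgebraicClosure (v.adicCompletion ℚ)) = b := hgRM _ b.2
  have hkey : u * (g • θ) = θ := by
    have h1 : u * (g • θ) = ∑ i ∈ Finset.range (2 ^ R), c (i + 1) * (g ^ (i + 1)) •
        (b : AlgebraicClosure (v.adicCompletion ℚ)) := by
      rw [hθ, Finset.smul_sum, Finset.mul_sum]
      refine Finset.sum_congr rfl fun i _ ↦ ?_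
      rw [smul_mul', ← mul_assoc, hshift i, ← mul_smul, ← pow_succ']
    have h2 := Finset.sum_range_succ' (fun i ↦ c i * (g ^ i) • (b : AlgebraicClosure (v.adicCompletion ℚ))) (2 ^ R)
    have h3 := Finset.sum_range_succ (fun i ↦ c i * (g ^ i) • (b : AlgebraicClosure (v.adicCompletion ℚ))) (2 ^ R)
    rw [h1]
    simp only [pow_zero, one_smul, hc0, one_mul] at h2
    rw [h3, hcN, hgb, one_mul, ← hθ] at h2
    linear_combination -h2
  -- `y = θ⁻¹`
  have hgθ0 : g • θ ≠ 0 := by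
    intro h0
    rw [h0, mul_zero] at hkey
    exact hθ0 hkey.symm
  have hθM : θ ∈ M := by
    rw [hθ]
    refine sum_mem fun i _ ↦ mul_mem ?_ (hstab _ _ b.2)
    exact prod_mem fun j _ ↦ hstab _ _ huM
  refine ⟨θ⁻¹, inv_ne_zero hθ0, fun h hh hht ↦ ?_, ?_⟩
  · rw [smul_inv'', (hmemM θ).mp hθM h hh hht]
  · rw [smul_inv'', eq_div_iff (inv_ne_zero hθ0)]
    field_simp
    linear_combination hkey

end Literature.NumberTheory.EllipticCurves.Greenberg1999.MultTowerNS2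

end Part1

/-!
## Part 2 — port of `Summits/BirchSwinnertonDyer/BirchSwinnertonDyer/Theorems/ByReductionTypeAtTwoMultTowerSplitTowerAlgebra.lean`

# Route `ByReductionTypeAtTwo`, crux `MultUpperHalfAtTwo` (item stmt-BirchSwinnertonDyer-19922), TOWER road, the
# «ONE BIT AT A SPLIT MULTIPLICATIVE PRIME» rows: tower algebra at ANY prime `p` — topological generators of the local
# layer subgroups, finite levels, and cyclic Hilbert 90 for `⟨g⟩` acting on `K̄_v^{H_{n+R}}`

HONEST FRAMING (cell `bsd-2adic`, run/shared/lean/pub/bsd-2adic/, seat `bsd-2adic-tower-1` GEN 10, HUMAN RULINGS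
D-0036 / D-0054 / D-0074): TOOL theorems only (no definition, no named fact, no `sorry`); closes nothing by itself;
nothing booked; BSD is not proved by any of this. These are the `p`-general versions of three bricks of the seat's GEN 9
kernelisation of `hNS2one` (`…MultTowerNS2TowerCosets.lean`, `…MultTowerNS2TwistedTateAlgebra.lean`, stated there for the
cyclotomic `ℤ₂`-extension and the twisted field `K̄^{H ∩ Stab t}`), needed for the KERNEL PROOF of the PRINT binder
`hSP1 = Greenberg1999.sec3_natCard_pTorsion_localTowerKerPrimary_le_splitMultiplicative_rat` (Greenberg, LNM 1716, §3,
pp. 91–92: at a SPLIT multiplicative `v ∣ p` the local tower kernel is a subgroup of `ℚ_p/ℤ_p`, so `#𝒦_{v,n}[p] ≤ p`),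
file `…MultTowerSplitOneBitHolds.lean` (cell memo HOME/mult/NOTE-SP1ONE.md §5).
Setting: `p` any prime, `κ` the cyclotomic `ℤ_p`-extension of `ℚ`, `v ∋ p`, `K = ℚ_v`, `Γ = Gal(K̄/K)`,
`H_m = localSubgroup (κ.layerSubgroup m) K`, `H_∞ = localSubgroup κ.kerSubgroup K`, `F_m = K̄^{H_m}`.

* `exists_units_kappa_resGal_eq_of_generate` — for `g ∈ H_n` generating `H_n` topologically together with `H_∞`
  (the binder shape of BRICK 11 `MultTowerNS2.finite_torsionBy_localTowerKerPrimary_and_card_le`): `κ(res g) = p^n·u`, `u ∈ ℤ_pˣ`;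
* `pow_mem_localSubgroup_layerSubgroup_iff` — `g^i ∈ H_{n+R} ↔ p^R ∣ i` for such `g`;
* `localSubgroup_layerSubgroup_antitone`, `mem_localSubgroup_kerSubgroup_of_forall` (`⋂ H_m = H_∞`; any `K`, `E`),
  `exists_forall_mem_localSubgroup_layerSubgroup_smul_eq` — **finite level**: an element of `K̄` fixed by `H_∞` is fixed
  by some `H_m` (compactness of `Γ`);
* `smul_mem_fixedField_of_normal` — `K̄^{N}` is `Γ`-stable for `N ⊴ Γ`;
* `prod_smul_pow`, `smul_prod_smul_eq`, `prod_smul_range_mul_eq_pow` — orbit products `N_m(w) = ∏_{i<m} g^i w`: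
  `N_m(w^k) = N_m(w)^k`, `g N_m(w) = N_m(w)` and `N_{mk}(w) = N_m(w)^k` when `g^m w = w`;
* `exists_eq_smul_div_of_prod_smul_eq_one` — **cyclic Hilbert 90 for the local layer**: `u ∈ F_{n+R}` with
  `∏_{i<p^R} g^i u = 1` is `g(y)/y` with `y ∈ F_{n+R}ˣ` (Artin's independence of characters + Lagrange resolvent).

References: L. Washington, *Introduction to Cyclotomic Fields*, §13.1; J. Neukirch, *ANT* IV §1, IV (3.5);
E. Artin, *Galois Theory* (independence of characters); cell memo NOTE-SP1ONE.md §5.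
-/

section Part2

set_option autoImplicit false

open scoped _root_.Classical _root_.IntermediateField

universe u

namespace Literature.NumberTheory.EllipticCurves.Greenberg1999.MultTowerSP1

open _root_.NumberField _root_.IsDedekindDomain _root_.Field _root_.PadicInt _root_.Literature.NumberTheory.EllipticCurves
  _root_.Literature.NumberTheory.GaloisRepresentations

variable {p : ℕ} [Fact p.Prime] {κ : ZpExtension ℚ p}

/-! ### `κ(res g)` for a topological generator -/

/-- **`κ(res g) = p^n · u`, `u` a unit**, for `g ∈ H_n` generating `H_n` topologically together with `H_∞` (otherwise
`g ∈ H_{n+1}`, an open subgroup containing `H_∞`, and `H_n ≤ H_{n+1}` contradicts `[H_n : H_{n+1}] = p`, BRICK 8).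
The `p`-general form of `MultTowerNS2.exists_units_kappa_resGal_eq_of_generate`. [cite: Washington1997, §13.1] -/
theorem exists_units_kappa_resGal_eq_of_generate (hκ : κ.IsCyclotomic) (v : HeightOneSpectrum (𝓞 ℚ))
    (hv : ((p : ℕ) : 𝓞 ℚ) ∈ v.asIdeal) (n : ℕ) {g : absoluteGaloisGroup (v.adicCompletion ℚ)}
    (hg : g ∈ localSubgroup (κ.layerSubgroup n) (v.adicCompletion ℚ))
    (hgen : ∀ U : Subgroup (absoluteGaloisGroup (v.adicCompletion ℚ)),
      IsOpen (U : Set (absoluteGaloisGroup (v.adicCompletion ℚ))) →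
        localSubgroup κ.kerSubgroup (v.adicCompletion ℚ) ≤ U → g ∈ U →
          localSubgroup (κ.layerSubgroup n) (v.adicCompletion ℚ) ≤ U) :
    ∃ u : ℤ_[p]ˣ, ((κ (resGal (K := ℚ) (v.adicCompletion ℚ) g)).toAdd : ℤ_[p]) = (p : ℤ_[p]) ^ n * (u : ℤ_[p]) := by
  rw [mem_localSubgroup_iff, ZpExtension.mem_layerSubgroup] at hg
  obtain ⟨b, hb⟩ := hg
  by_cases hbu : IsUnit b
  · exact ⟨hbu.unit, by rw [IsUnit.unit_spec]; exact hb⟩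
  exfalso
  -- `p ∣ b`, so `g ∈ H_{n+1}`
  have hb1 : ‖b‖ < 1 := lt_of_le_of_ne (PadicInt.norm_le_one b) (fun h ↦ hbu (PadicInt.isUnit_iff.mpr h))
  rw [PadicInt.norm_lt_one_iff_dvd] at hb1
  obtain ⟨c, rfl⟩ := hb1
  have hg1 : g ∈ localSubgroup (κ.layerSubgroup (n + 1)) (v.adicCompletion ℚ) := by
    rw [mem_localSubgroup_iff, ZpExtension.mem_layerSubgroup]
    exact ⟨c, by rw [hb]; ring⟩
  have hle := hgen _ (MultTowerNS2.isOpen_localSubgroup _ (κ.isOpen_layerSubgroup (n + 1)) _)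
    (fun τ hτ ↦ by
      rw [mem_localSubgroup_iff] at hτ ⊢
      exact κ.kerSubgroup_le_layerSubgroup (n + 1) hτ) hg1
  have hidx := MultTowerNS2.relIndex_localSubgroup_layerSubgroup_succ hκ v hv n
  rw [Subgroup.relIndex_eq_one.mpr hle] at hidx
  exact (Fact.out : p.Prime).one_lt.ne hidx

/-- **`g^i ∈ H_{n+R} ↔ p^R ∣ i`** for `g` with `κ(res g) = p^n u`, `u` a unit. The `p`-general form of
`MultTowerNS2.pow_mem_localSubgroup_layerSubgroup_iff`. [cite: Washington1997, §13.1] -/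
theorem pow_mem_localSubgroup_layerSubgroup_iff (v : HeightOneSpectrum (𝓞 ℚ)) (n R : ℕ)
    {g : absoluteGaloisGroup (v.adicCompletion ℚ)} {u : ℤ_[p]ˣ}
    (hu : ((κ (resGal (K := ℚ) (v.adicCompletion ℚ) g)).toAdd : ℤ_[p]) = (p : ℤ_[p]) ^ n * (u : ℤ_[p])) (i : ℕ) :
    g ^ i ∈ localSubgroup (κ.layerSubgroup (n + R)) (v.adicCompletion ℚ) ↔ p ^ R ∣ i := by
  rw [mem_localSubgroup_iff, ZpExtension.mem_layerSubgroup]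
  simp only [map_pow, toAdd_pow, hu, nsmul_eq_mul, pow_add]
  have hpn : (p : ℤ_[p]) ^ n ≠ 0 := pow_ne_zero _ (NeZero.ne _)
  rw [show (i : ℤ_[p]) * ((p : ℤ_[p]) ^ n * (u : ℤ_[p])) = (p : ℤ_[p]) ^ n * ((i : ℤ_[p]) * u) by ring,
    mul_dvd_mul_iff_left hpn, Units.dvd_mul_right,
    show ((i : ℤ_[p])) = ((i : ℤ) : ℤ_[p]) by push_cast; rfl, PadicInt.pow_p_dvd_int_iff]
  exact_mod_cast Iff.rfl

/-! ### Finite levels -/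

section AnyField

variable {K : Type u} [Field K] (κK : ZpExtension K p) (E : Type u) [Field E] [Algebra K E]

/-- The local layer subgroups decrease: `H_{E,m'} ≤ H_{E,m}` for `m ≤ m'` (any `ℤ_p`-extension of any field `K`, any
`K`-field `E`). [cite: Washington1997, §13.1] -/
theorem localSubgroup_layerSubgroup_antitone {m m' : ℕ} (h : m ≤ m') :
    localSubgroup (κK.layerSubgroup m') E ≤ localSubgroup (κK.layerSubgroup m) E :=
  Subgroup.comap_mono (κK.layerSubgroup_antitone h)

/-- `⋂_m H_{E,m} = H_{E,∞}`: an element of `Γ_E` lying in every local layer subgroup lies in the local kernel subgroup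
(its image in `Γ_K` lies in every `κ⁻¹(p^m ℤ_p)`, hence in `ker κ`: `ZpExtension.mem_kerSubgroup_of_forall_mem_layerSubgroup`).
[cite: Washington1997, §13.1] -/
theorem mem_localSubgroup_kerSubgroup_of_forall {σ : absoluteGaloisGroup E}
    (hσ : ∀ m, σ ∈ localSubgroup (κK.layerSubgroup m) E) : σ ∈ localSubgroup κK.kerSubgroup E := by
  rw [mem_localSubgroup_iff]
  exact ZpExtension.mem_kerSubgroup_of_forall_mem_layerSubgroup κK fun m ↦ (mem_localSubgroup_iff _ _ _).mp (hσ m)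

end AnyField

/-- **Finite level**: if `x ∈ K̄_v` is fixed by every element of `H_∞`, then for some `m` it is fixed by every element
of `H_m` — the sets `H_m ∖ Fix(x)` are compact, decreasing in `m`, with empty intersection. The `p`-general form of
`MultTowerNS2.exists_forall_mem_localSubgroup_layerSubgroup_smul_eq` (case `S = ⊤`). [cite: NeukirchANT1999, Ch. IV §1] -/
theorem exists_forall_mem_localSubgroup_layerSubgroup_smul_eq (v : HeightOneSpectrum (𝓞 ℚ))
    (x : AlgebraicClosure (v.adicCompletion ℚ))
    (hx : ∀ h ∈ localSubgroup κ.kerSubgroup (v.adicCompletion ℚ), h • x = x) :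
    ∃ m : ℕ, ∀ h ∈ localSubgroup (κ.layerSubgroup m) (v.adicCompletion ℚ), h • x = x := by
  -- the open subgroup `U = Gal(K̄/K(x))` of elements fixing `x`
  let H : ℕ → Subgroup (absoluteGaloisGroup (v.adicCompletion ℚ)) :=
    fun m ↦ localSubgroup (κ.layerSubgroup m) (v.adicCompletion ℚ)
  have hHanti : ∀ m, H (m + 1) ≤ H m := fun m ↦ MultTowerNS2.localSubgroup_layerSubgroup_succ_le (κ := κ) v m
  have hHopen : ∀ m, IsOpen (H m : Set (absoluteGaloisGroup (v.adicCompletion ℚ))) :=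
    fun m ↦ MultTowerNS2.isOpen_localSubgroup _ (κ.isOpen_layerSubgroup m) _
  have hHker : ∀ σ : absoluteGaloisGroup (v.adicCompletion ℚ), (∀ m, σ ∈ H m) →
      σ ∈ localSubgroup κ.kerSubgroup (v.adicCompletion ℚ) := fun σ h ↦
    mem_localSubgroup_kerSubgroup_of_forall κ (v.adicCompletion ℚ) h
  have hint : IsIntegral (v.adicCompletion ℚ) x := Algebra.IsIntegral.isIntegral x
  haveI : FiniteDimensional (v.adicCompletion ℚ) (v.adicCompletion ℚ)⟮x⟯ := IntermediateField.adjoin.finiteDimensional hint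
  let U : Subgroup (absoluteGaloisGroup (v.adicCompletion ℚ)) := ((v.adicCompletion ℚ)⟮x⟯).fixingSubgroup
  have hUopen : IsOpen (U : Set (absoluteGaloisGroup (v.adicCompletion ℚ))) :=
    IntermediateField.fixingSubgroup_isOpen _
  have hUfix : ∀ σ ∈ U, σ • x = x := fun σ hσ ↦
    (IntermediateField.mem_fixingSubgroup_iff _ _).mp hσ x (IntermediateField.mem_adjoin_simple_self _ x)
  have hfixU : ∀ σ : absoluteGaloisGroup (v.adicCompletion ℚ), σ • x = x → σ ∈ U := by
    intro σ hσ
    have hle : (v.adicCompletion ℚ)⟮x⟯ ≤ IntermediateField.fixedField (Subgroup.zpowers σ) := by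
      rw [IntermediateField.adjoin_simple_le_iff, IntermediateField.mem_fixedField_iff]
      rintro τ ⟨k, rfl⟩
      exact MulAction.mem_stabilizer_iff.mp
        ((MulAction.stabilizer (absoluteGaloisGroup (v.adicCompletion ℚ)) x).zpow_mem
          (MulAction.mem_stabilizer_iff.mpr hσ) k)
    exact (IntermediateField.mem_fixingSubgroup_iff _ _).mpr fun y hy ↦
      (IntermediateField.mem_fixedField_iff _ _).mp (hle hy) σ (Subgroup.mem_zpowers σ)
  -- the compact sets `H m \ U`
  by_contra hcon
  have hcon' : ∀ m, ∃ h, h ∈ H m ∧ h • x ≠ x := by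
    intro m
    by_contra hm
    refine hcon ⟨m, fun h hh ↦ ?_⟩
    by_contra hne
    exact hm ⟨h, hh, hne⟩
  let t : ℕ → Set (absoluteGaloisGroup (v.adicCompletion ℚ)) := fun m ↦ (H m : Set _) \ (U : Set _)
  have htd : ∀ m, t (m + 1) ⊆ t m := fun m σ hσ ↦ ⟨hHanti m hσ.1, hσ.2⟩
  have htn : ∀ m, (t m).Nonempty := by
    intro m
    obtain ⟨h, hh, hne⟩ := hcon' m
    exact ⟨h, hh, fun hU ↦ hne (hUfix h hU)⟩
  have htcl : ∀ m, IsClosed (t m) := fun m ↦ ((H m).isClosed_of_isOpen (hHopen m)).sdiff hUopen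
  -- (`CharZero ℚ_v` enters the context only now, for the compactness of `Γ`)
  haveI : CharZero (v.adicCompletion ℚ) :=
    charZero_of_injective_algebraMap (algebraMap ℚ (v.adicCompletion ℚ)).injective
  obtain ⟨σ, hσ⟩ := IsCompact.nonempty_iInter_of_sequence_nonempty_isCompact_isClosed t htd htn
    (htcl 0).isCompact htcl
  rw [Set.mem_iInter] at hσ
  have hσU : σ ∉ U := (hσ 0).2
  have hσi := hHker σ fun m ↦ (hσ m).1
  exact hσU (hfixU σ (hx σ hσi))

/-! ### Orbit products `N_m(w) = ∏_{i<m} g^i w` (complements to BRICK 16a) -/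

section Orbit

variable {K : Type*} [Field K]

/-- **`K̄^N` is `Γ`-stable for `N ⊴ Γ`**: if `x` is fixed by every element of `N`, so is `σ x`. [folklore] -/
private theorem smul_mem_fixedField_of_normal (N : Subgroup (absoluteGaloisGroup K)) [hN : N.Normal] {x : AlgebraicClosure K}
    (hx : ∀ h ∈ N, h • x = x) (σ : absoluteGaloisGroup K) : ∀ h ∈ N, h • (σ • x) = σ • x := by
  intro h hh
  have hconj : σ⁻¹ * h * σ⁻¹⁻¹ ∈ N := hN.conj_mem h hh σ⁻¹
  rw [inv_inv] at hconj
  have h1 : (σ⁻¹ * h * σ) • x = x := hx _ hconj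
  rw [mul_smul, mul_smul, inv_smul_eq_iff] at h1
  exact h1

/-- `N_m(w^k) = N_m(w)^k`. [folklore] -/
private theorem prod_smul_pow (g : absoluteGaloisGroup K) (m k : ℕ) (w : AlgebraicClosure K) :
    (∏ i ∈ Finset.range m, (g ^ i) • (w ^ k)) = (∏ i ∈ Finset.range m, (g ^ i) • w) ^ k := by
  rw [← Finset.prod_pow]
  exact Finset.prod_congr rfl fun i _ ↦ smul_pow' _ _ _

/-- `g N_m(w) = N_m(w)` when `g^m w = w`. [folklore] -/
private theorem smul_prod_smul_eq (g : absoluteGaloisGroup K) (m : ℕ) {w : AlgebraicClosure K} (hw : (g ^ m) • w = w) :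
    g • (∏ i ∈ Finset.range m, (g ^ i) • w) = ∏ i ∈ Finset.range m, (g ^ i) • w := by
  rw [Finset.smul_prod', ← MultTowerNS2.prod_smul_smul_eq g m hw]
  refine Finset.prod_congr rfl fun i _ ↦ ?_
  rw [← mul_smul, ← mul_smul, ← pow_succ, ← pow_succ']

/-- `N_{mk}(w) = N_m(w)^k` when `g^m w = w` (splitting the range `[0, mk)` into `k` blocks of length `m`, each with
product `g^{mj} N_m(w) = N_m(w)`). [folklore] -/
private theorem prod_smul_range_mul_eq_pow (g : absoluteGaloisGroup K) (m : ℕ) {w : AlgebraicClosure K}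
    (hw : (g ^ m) • w = w) (k : ℕ) :
    (∏ i ∈ Finset.range (m * k), (g ^ i) • w) = (∏ i ∈ Finset.range m, (g ^ i) • w) ^ k := by
  have hfix : ∀ j : ℕ, (g ^ (m * j)) • (∏ i ∈ Finset.range m, (g ^ i) • w) = ∏ i ∈ Finset.range m, (g ^ i) • w := by
    intro j
    induction j with
    | zero => rw [mul_zero, pow_zero, one_smul]
    | succ j ih => rw [Nat.mul_succ, pow_add, mul_smul, MultTowerNS2.pow_smul_prod_smul_eq g m hw, ih]
  induction k with
  | zero => rw [mul_zero, Finset.prod_range_zero, pow_zero]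
  | succ k ih =>
    rw [Nat.mul_succ, Finset.prod_range_add, ih, pow_succ]
    congr 1
    rw [← hfix k, Finset.smul_prod']
    exact Finset.prod_congr rfl fun i _ ↦ by rw [pow_add, mul_smul]

end Orbit

/-! ### Cyclic Hilbert 90 for `⟨g⟩` acting on `K̄^{H_{n+R}}` -/

/-- **Cyclic Hilbert 90 for the local layer (any `p`).** `κ` the cyclotomic `ℤ_p`-extension, `g ∈ Γ_{ℚ_v}` with
`κ(res g) = p^n u_g` (`u_g` a unit), `F = K̄_v^{H_{n+R}}`: the group `⟨g⟩` acts on `F` through a cyclic group of order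
`p^R`, and an element `u ∈ F` with `∏_{i<p^R} g^i u = 1` is `g(y)/y` for some `y ∈ Fˣ`. Proof: the `p^R` characters
`x ↦ g^i x` of `Fˣ` are distinct (`g^i ∉ H_{n+R} = Gal(K̄/F)` for `0 < i < p^R`), hence linearly independent (Artin;
Mathlib `linearIndependent_monoidHom`), so some Lagrange resolvent `θ = ∑_i (∏_{j<i} g^j u) g^i b` is non-zero; it
satisfies `u · gθ = θ`, and `y = θ⁻¹`. The `p`-general, untwisted form of
`MultTowerNS2.exists_eq_smul_div_of_prod_smul_eq_one`. [cite: NeukirchANT1999, Ch. IV (3.5)] -/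
theorem exists_eq_smul_div_of_prod_smul_eq_one (v : HeightOneSpectrum (𝓞 ℚ)) (n R : ℕ)
    {g : absoluteGaloisGroup (v.adicCompletion ℚ)} {ug : ℤ_[p]ˣ}
    (hug : ((κ (resGal (K := ℚ) (v.adicCompletion ℚ) g)).toAdd : ℤ_[p]) = (p : ℤ_[p]) ^ n * (ug : ℤ_[p]))
    {u : AlgebraicClosure (v.adicCompletion ℚ)}
    (hu : ∀ h ∈ localSubgroup (κ.layerSubgroup (n + R)) (v.adicCompletion ℚ), h • u = u)
    (hN : (∏ i ∈ Finset.range (p ^ R), (g ^ i) • u) = 1) :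
    ∃ y : AlgebraicClosure (v.adicCompletion ℚ), y ≠ 0 ∧
      (∀ h ∈ localSubgroup (κ.layerSubgroup (n + R)) (v.adicCompletion ℚ), h • y = y) ∧
      u = g • y / y := by
  -- the field `F = K̄^{H_{n+R}}`
  set Hm := localSubgroup (κ.layerSubgroup (n + R)) (v.adicCompletion ℚ) with hHm
  haveI hnormal : Hm.Normal := by rw [hHm, localSubgroup_eq_comap]; exact Subgroup.Normal.comap inferInstance _
  let M : IntermediateField (v.adicCompletion ℚ) (AlgebraicClosure (v.adicCompletion ℚ)) :=
    IntermediateField.fixedField Hm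
  have hmemM : ∀ x, x ∈ M ↔ ∀ h ∈ Hm, h • x = x := by
    intro x
    rw [IntermediateField.mem_fixedField_iff]
    constructor
    · intro hx h hh
      exact hx h hh
    · intro hx f hf
      let f' : absoluteGaloisGroup (v.adicCompletion ℚ) := f
      have hf' : f' ∈ Hm := hf
      exact hx f' hf'
  have hstab : ∀ σ : absoluteGaloisGroup (v.adicCompletion ℚ), ∀ x ∈ M, σ • x ∈ M := fun σ x hx ↦
    (hmemM _).mpr (smul_mem_fixedField_of_normal Hm ((hmemM x).mp hx) σ)
  have hgi : ∀ i : ℕ, g ^ i ∈ Hm ↔ p ^ R ∣ i := pow_mem_localSubgroup_layerSubgroup_iff (κ := κ) v n R hug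
  have hgRM : ∀ x ∈ M, (g ^ p ^ R) • x = x := fun x hx ↦ (hmemM x).mp hx _ ((hgi _).mpr dvd_rfl)
  have huM : u ∈ M := (hmemM u).mpr hu
  have hopen : IsOpen (Hm : Set (absoluteGaloisGroup (v.adicCompletion ℚ))) :=
    MultTowerNS2.isOpen_localSubgroup _ (κ.isOpen_layerSubgroup (n + R)) _
  -- `u ≠ 0`
  have hR0 : 0 < p ^ R := pow_pos (Fact.out : p.Prime).pos R
  have hu0 : u ≠ 0 := by
    intro h0
    have hz : (∏ i ∈ Finset.range (p ^ R), (g ^ i) • u) = 0 :=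
      Finset.prod_eq_zero (Finset.mem_range.mpr hR0) (by rw [h0, smul_zero])
    rw [hz] at hN
    exact zero_ne_one hN
  -- (`CharZero ℚ_v` from here on; no term mentioning `localSubgroup` is written after this point)
  haveI : CharZero (v.adicCompletion ℚ) :=
    charZero_of_injective_algebraMap (algebraMap ℚ (v.adicCompletion ℚ)).injective
  have hfix := fixingSubgroup_fixedField_of_isOpen _ hopen
  have hHfix := fun σ ↦ SetLike.ext_iff.mp hfix σ
  -- the characters `x ↦ g^i x` of `M`, `i < p^R`, are distinct
  let χ : Fin (p ^ R) → (M →* AlgebraicClosure (v.adicCompletion ℚ)) := fun i ↦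
    { toFun := fun x ↦ (g ^ (i : ℕ)) • (x : AlgebraicClosure (v.adicCompletion ℚ))
      map_one' := by simp
      map_mul' := fun x y ↦ by
        rw [IntermediateField.coe_mul]
        exact smul_mul' _ _ _ }
  have hχapp : ∀ (i : Fin (p ^ R)) (x : M), χ i x = (g ^ (i : ℕ)) • (x : AlgebraicClosure (v.adicCompletion ℚ)) :=
    fun _ _ ↦ rfl
  have key : ∀ i i' : Fin (p ^ R), (i : ℕ) < i' → χ i = χ i' → False := by
    intro i i' hlt heq
    set d : ℕ := (i' : ℕ) - i with hd
    have hd0 : 0 < d := by omega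
    have hdlt : d < p ^ R := by omega
    have hgd : g ^ d ∉ Hm := by
      rw [hgi]
      intro hdvd
      exact absurd (Nat.le_of_dvd hd0 hdvd) (by omega)
    -- some `b ∈ F` is moved by `g^d`
    have hnot : ¬ ∀ b : M, (g ^ d) • (b : AlgebraicClosure (v.adicCompletion ℚ)) = b := by
      intro hall
      exact hgd ((hHfix (g ^ d)).mp ((mem_fixingSubgroup_iff_forall_smul M (g ^ d)).mpr hall))
    push Not at hnot
    obtain ⟨b, hgb⟩ := hnot
    have h1 := DFunLike.congr_fun heq b
    rw [hχapp, hχapp] at h1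
    rw [show (i' : ℕ) = (i : ℕ) + d by omega, pow_add, mul_smul] at h1
    exact hgb (smul_left_cancel (g ^ (i : ℕ)) h1.symm)
  have hχinj : Function.Injective χ := by
    intro i i' h
    rcases lt_trichotomy (i : ℕ) i' with hlt | heq | hgt
    · exact (key i i' hlt h).elim
    · exact Fin.ext heq
    · exact (key i' i hgt h.symm).elim
  -- Artin: the characters are linearly independent, so some Lagrange resolvent is non-zero
  have hli := (linearIndependent_monoidHom M (AlgebraicClosure (v.adicCompletion ℚ))).comp χ hχinj
  let c : ℕ → AlgebraicClosure (v.adicCompletion ℚ) := fun i ↦ ∏ j ∈ Finset.range i, (g ^ j) • u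
  have hc0 : c 0 = 1 := Finset.prod_range_zero _
  have hcN : c (p ^ R) = 1 := hN
  obtain ⟨b, hb⟩ : ∃ b : M,
      (∑ i : Fin (p ^ R), c i * (g ^ (i : ℕ)) • (b : AlgebraicClosure (v.adicCompletion ℚ))) ≠ 0 := by
    by_contra hall
    push Not at hall
    have hsum : (∑ i : Fin (p ^ R), c i • ((χ i : M →* AlgebraicClosure (v.adicCompletion ℚ)) :
        M → AlgebraicClosure (v.adicCompletion ℚ))) = 0 := by
      funext x
      rw [Finset.sum_apply, Pi.zero_apply]
      simp only [Pi.smul_apply, smul_eq_mul]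
      exact hall x
    have h0 := Fintype.linearIndependent_iff.mp hli (fun i ↦ c i) hsum ⟨0, hR0⟩
    exact one_ne_zero (hc0 ▸ h0)
  -- the resolvent `θ` and the identity `u · gθ = θ`
  set θ : AlgebraicClosure (v.adicCompletion ℚ) :=
    ∑ i ∈ Finset.range (p ^ R), c i * (g ^ i) • (b : AlgebraicClosure (v.adicCompletion ℚ)) with hθ
  have hθb : (∑ i : Fin (p ^ R), c i * (g ^ (i : ℕ)) • (b : AlgebraicClosure (v.adicCompletion ℚ))) = θ :=
    Fin.sum_univ_eq_sum_range (fun i ↦ c i * (g ^ i) • (b : AlgebraicClosure (v.adicCompletion ℚ))) (p ^ R)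
  have hθ0 : θ ≠ 0 := hθb ▸ hb
  have hshift : ∀ i : ℕ, u * (g • c i) = c (i + 1) := by
    intro i
    change u * (g • ∏ j ∈ Finset.range i, (g ^ j) • u) = ∏ j ∈ Finset.range (i + 1), (g ^ j) • u
    rw [Finset.prod_range_succ', pow_zero, one_smul, Finset.smul_prod', mul_comm]
    congr 1
    exact Finset.prod_congr rfl fun j _ ↦ by rw [← mul_smul, ← pow_succ']
  have hgb : (g ^ p ^ R) • (b : AlgebraicClosure (v.adicCompletion ℚ)) = b := hgRM _ b.2
  have hkey : u * (g • θ) = θ := by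
    have h1 : u * (g • θ) = ∑ i ∈ Finset.range (p ^ R), c (i + 1) * (g ^ (i + 1)) •
        (b : AlgebraicClosure (v.adicCompletion ℚ)) := by
      rw [hθ, Finset.smul_sum, Finset.mul_sum]
      refine Finset.sum_congr rfl fun i _ ↦ ?_
      rw [smul_mul', ← mul_assoc, hshift i, ← mul_smul, ← pow_succ']
    have h2 := Finset.sum_range_succ' (fun i ↦ c i * (g ^ i) • (b : AlgebraicClosure (v.adicCompletion ℚ))) (p ^ R)
    have h3 := Finset.sum_range_succ (fun i ↦ c i * (g ^ i) • (b : AlgebraicClosure (v.adicCompletion ℚ))) (p ^ R)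
    rw [h1]
    simp only [pow_zero, one_smul, hc0, one_mul] at h2
    rw [h3, hcN, hgb, one_mul, ← hθ] at h2
    linear_combination -h2
  -- `y = θ⁻¹`
  have hgθ0 : g • θ ≠ 0 := by
    intro h0
    rw [h0, mul_zero] at hkey
    exact hθ0 hkey.symm
  have hθM : θ ∈ M := by
    rw [hθ]
    refine sum_mem fun i _ ↦ mul_mem ?_ (hstab _ _ b.2)
    exact prod_mem fun j _ ↦ hstab _ _ huM
  refine ⟨θ⁻¹, inv_ne_zero hθ0, fun h hh ↦ ?_, ?_⟩
  · rw [smul_inv'', (hmemM θ).mp hθM h hh]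
  · rw [smul_inv'', eq_div_iff (inv_ne_zero hθ0)]
    field_simp
    linear_combination hkey

end Literature.NumberTheory.EllipticCurves.Greenberg1999.MultTowerSP1

end Part2

/-!
## Part 3 — port of `Summits/BirchSwinnertonDyer/BirchSwinnertonDyer/Theorems/ByReductionTypeAtTwoMultTowerNS2TateTransport.lean`

# Route `ByReductionTypeAtTwo`, crux `MultUpperHalfAtTwo` (item stmt-BirchSwinnertonDyer-19922), TOWER road, the
# «ONE BIT AT A NON-SPLIT 2» rows: KERNEL BRICK 18 — transport along Tate's twisted uniformisation:
# `M_∞ = E(K̄_v)^{H_∞} = Ψ(T)`, `T = {x ∈ (K̄_v^{H_∞ ∩ Stab t})ˣ : τ₀x·x ∈ q^ℤ}`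

HONEST FRAMING (cell `bsd-2adic`, run/shared/lean/pub/bsd-2adic/, seat `bsd-2adic-tower-1` GEN 9, HUMAN RULINGS
D-0036 / D-0054 / D-0074): TOOL theorems only (no definition, no named fact, no `sorry`); closes nothing by itself;
nothing booked; BSD is not proved by any of this. Module M7 (step S1 of the scope memo
HOME/tower/SCOPE-hNS2one-kernel-GEN8.md) of the KERNELISATION of the MEMO binder
`MultTowerNS2.localTowerKerTwoTorsion_le_two_nonsplitTwo_of_tateUnit`. The hypotheses `hker` / `hequiv` are the kernel
and the (value form of the) twisted equivariance delivered by `TateCurve.exists_twistedTateUniformisation_tateJ`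
(`Ψ : K̄_vˣ → E(K̄_v)`, kernel `q^ℤ`, `σΨ(u) = χ(σ)Ψ(σu)`, `χ(σ) = 1 ⇔ σ t = t`); `τ₀ ∈ H_∞` is a flip of `t` (BRICK 10).

* `smul_eq_self_of_smul_eq_zpow_mul` — orbit finiteness: `h x = Q^j x`, `hQ = Q`, `Q` of infinite order ⇒ `h x = x`;
* `tatePsi_eq_iff` — `Ψ(a) = Ψ(b) ⇔ a ∈ q^ℤ b`;
* `exists_unit_of_mem_fixedPoints` — `M_∞ ⊆ Ψ(T)`; `apply_mem_fixedPoints` — `Ψ(T) ⊆ M_∞`.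

References: R. Greenberg, LNM 1716 (1999), §3 pp. 87–93; J. Silverman, GTM 151, Thm. V.3.1, Lemma V.5.2, Thm. V.5.3.
-/

section Part3

set_option autoImplicit false

open scoped _root_.Classical

namespace Literature.NumberTheory.EllipticCurves.Greenberg1999.MultTowerNS2

open _root_.NumberField _root_.IsDedekindDomain _root_.Field _root_.Literature.NumberTheory.EllipticCurves
  _root_.Literature.NumberTheory.GaloisRepresentations

variable {κ : ZpExtension ℚ 2}

/-! ### An orbit-finiteness lemma -/

/-- **If `h x = Q^j x` with `h Q = Q` and `Q` of infinite order, then `h x = x`.** The `h`-orbit of the algebraic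
element `x` lies in the root set of its minimal polynomial, so `h^d x = x` for some `d ≥ 1`, while
`h^d x = Q^{jd} x`; hence `Q^{jd} = 1`, `j = 0`. [folklore] -/
private theorem smul_eq_self_of_smul_eq_zpow_mul (v : HeightOneSpectrum (𝓞 ℚ))
    {h : absoluteGaloisGroup (v.adicCompletion ℚ)} {Q x : AlgebraicClosure (v.adicCompletion ℚ)}
    (hQfix : h • Q = Q) (hQ0 : Q ≠ 0) (hQtor : ∀ j : ℤ, Q ^ j = 1 → j = 0) (hx0 : x ≠ 0) {j : ℤ}
    (hj : h • x = Q ^ j * x) : h • x = x := by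
  -- `h^m x = Q^{jm} x`
  have hpow : ∀ m : ℕ, (h ^ m) • x = Q ^ (j * m) * x := fun m ↦ by
    induction m with
    | zero => simp
    | succ m ih =>
      rw [pow_succ', mul_smul, ih, smul_mul', smul_zpow₀', hQfix, hj, ← mul_assoc, ← zpow_add₀ hQ0]
      push_cast
      ring_nf
  -- the orbit lies in the (finite) root set of the minimal polynomial
  have hint : IsIntegral (v.adicCompletion ℚ) x := Algebra.IsIntegral.isIntegral x
  have hmem : ∀ m : ℕ, (h ^ m) • x ∈ (minpoly (v.adicCompletion ℚ) x).rootSet (AlgebraicClosure (v.adicCompletion ℚ)) :=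
    fun m ↦ by
      rw [Polynomial.mem_rootSet]
      refine ⟨minpoly.ne_zero hint, ?_⟩
      have e1 := Polynomial.aeval_algHom_apply
        ((absoluteGaloisGroup.toAlgEquiv (v.adicCompletion ℚ) (h ^ m) :
          AlgebraicClosure (v.adicCompletion ℚ) ≃ₐ[v.adicCompletion ℚ] AlgebraicClosure (v.adicCompletion ℚ)) :
          AlgebraicClosure (v.adicCompletion ℚ) →ₐ[v.adicCompletion ℚ] AlgebraicClosure (v.adicCompletion ℚ))
        x (minpoly (v.adicCompletion ℚ) x)
      rw [minpoly.aeval, map_zero] at e1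
      exact e1
  let f : ℕ → (minpoly (v.adicCompletion ℚ) x).rootSet (AlgebraicClosure (v.adicCompletion ℚ)) :=
    fun m ↦ ⟨(h ^ m) • x, hmem m⟩
  obtain ⟨m₁, m₂, hne, heq⟩ := Finite.exists_ne_map_eq_of_infinite f
  have heq' : (h ^ m₁) • x = (h ^ m₂) • x := congrArg Subtype.val heq
  -- `h^d x = x` with `d ≥ 1` forces `j = 0`
  have key : ∀ {a b : ℕ}, a < b → (h ^ a) • x = (h ^ b) • x → h • x = x := by
    intro a b hab hab'
    obtain ⟨d, rfl⟩ := Nat.exists_eq_add_of_lt hab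
    rw [show a + d + 1 = a + (d + 1) by ring, pow_add, mul_smul] at hab'
    have h1 : x = (h ^ (d + 1)) • x := smul_left_cancel _ hab'
    rw [hpow] at h1
    have h2 : Q ^ (j * (d + 1 : ℕ)) = 1 := by
      have h3 : Q ^ (j * (d + 1 : ℕ)) * x = 1 * x := by rw [one_mul]; exact h1.symm
      exact mul_right_cancel₀ hx0 h3
    have h4 := hQtor _ h2
    have hj0 : j = 0 := by
      rcases mul_eq_zero.mp h4 with h5 | h5
      · exact h5
      · exfalso; push_cast at h5; omega
    rw [hj, hj0, zpow_zero, one_mul]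
  rcases lt_or_gt_of_ne hne with hlt | hlt
  · exact key hlt heq'
  · exact key hlt heq'.symm

/-! ### The twisted Tate module: `M_∞ = Ψ(T)` -/

/-- **Two units have the same image under the Tate uniformisation iff they differ by a power of `q`** (kernel `q^ℤ`).
[cite: SilvermanATAEC1994, Thm. V.3.1 (c),(d) (PDF p. 395)] -/
theorem tatePsi_eq_iff (v : HeightOneSpectrum (𝓞 ℚ)) {W : WeierstrassCurve ℚ}
    {Ψ : Additive (AlgebraicClosure (v.adicCompletion ℚ))ˣ →+ localPoints W (v.adicCompletion ℚ)}
    {Q : AlgebraicClosure (v.adicCompletion ℚ)}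
    (hker : ∀ u : (AlgebraicClosure (v.adicCompletion ℚ))ˣ, Ψ (Additive.ofMul u) = 0 ↔
      ∃ j : ℤ, (u : AlgebraicClosure (v.adicCompletion ℚ)) = Q ^ j)
    (a b : (AlgebraicClosure (v.adicCompletion ℚ))ˣ) :
    Ψ (Additive.ofMul a) = Ψ (Additive.ofMul b) ↔
      ∃ j : ℤ, (a : AlgebraicClosure (v.adicCompletion ℚ)) = Q ^ j * (b : AlgebraicClosure (v.adicCompletion ℚ)) := by
  have hb := b.ne_zero
  rw [← sub_eq_zero, sub_eq_add_neg, ← map_neg, ← ofMul_inv, ← map_add, ← ofMul_mul, hker]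
  simp only [Units.val_mul, Units.val_inv_eq_inv_val]
  constructor
  · rintro ⟨j, hj⟩
    exact ⟨j, by rw [← hj]; field_simp⟩
  · rintro ⟨j, hj⟩
    exact ⟨j, by rw [hj]; field_simp⟩

section Transport

variable (v : HeightOneSpectrum (𝓞 ℚ)) {W : WeierstrassCurve ℚ}
  {Ψ : Additive (AlgebraicClosure (v.adicCompletion ℚ))ˣ →+ localPoints W (v.adicCompletion ℚ)}
  {t Q : AlgebraicClosure (v.adicCompletion ℚ)} {τ₀ : absoluteGaloisGroup (v.adicCompletion ℚ)}

/-- **`M_∞ ⊆ Ψ(T)`**: a point of `E(K̄_v)` fixed by `H_∞` is `Ψ(x)` with `x` fixed by `H_∞ ∩ Stab(t)` and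
`τ₀x · x ∈ q^ℤ` (`τ₀ ∈ H_∞` a flip of `t`). For `h ∈ H_∞ ∩ Stab(t)`: `Ψ(x) = hΨ(x) = Ψ(hx)`, so `hx = q^j x`,
and `hx = x` by orbit finiteness; for the flip: `Ψ(x) = τ₀Ψ(x) = −Ψ(τ₀x)`, so `Ψ(x·τ₀x) = 0`.
[cite: GreenbergLNM1716, §3 (pp. 87–93)] [cite: SilvermanATAEC1994, Lemma V.5.2 (c), Thm. V.5.3] -/
theorem exists_unit_of_mem_fixedPoints (hsurj : Function.Surjective Ψ)
    (hker : ∀ u : (AlgebraicClosure (v.adicCompletion ℚ))ˣ, Ψ (Additive.ofMul u) = 0 ↔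
      ∃ j : ℤ, (u : AlgebraicClosure (v.adicCompletion ℚ)) = Q ^ j)
    (hequiv : ∀ (σ : absoluteGaloisGroup (v.adicCompletion ℚ)) (u u' : (AlgebraicClosure (v.adicCompletion ℚ))ˣ),
      (u' : AlgebraicClosure (v.adicCompletion ℚ)) = σ • (u : AlgebraicClosure (v.adicCompletion ℚ)) →
        σ • Ψ (Additive.ofMul u) = (if σ • t = t then (1 : ℤ) else -1) • Ψ (Additive.ofMul u'))
    (hQfix : ∀ σ : absoluteGaloisGroup (v.adicCompletion ℚ), σ • Q = Q) (hQ0 : Q ≠ 0)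
    (hQtor : ∀ j : ℤ, Q ^ j = 1 → j = 0) (hne : -t ≠ t)
    (hτ₀ : τ₀ ∈ localSubgroup κ.kerSubgroup (v.adicCompletion ℚ)) (hτ₀t : τ₀ • t = -t)
    {m : localPoints W (v.adicCompletion ℚ)}
    (hm : ∀ h ∈ localSubgroup κ.kerSubgroup (v.adicCompletion ℚ), h • m = m) :
    ∃ x : (AlgebraicClosure (v.adicCompletion ℚ))ˣ, Ψ (Additive.ofMul x) = m ∧
      (∀ h ∈ localSubgroup κ.kerSubgroup (v.adicCompletion ℚ), h • t = t →
        h • (x : AlgebraicClosure (v.adicCompletion ℚ)) = x) ∧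
      ∃ a : ℤ, τ₀ • (x : AlgebraicClosure (v.adicCompletion ℚ)) * x = Q ^ a := by
  obtain ⟨x', hx'⟩ := hsurj m
  set x : (AlgebraicClosure (v.adicCompletion ℚ))ˣ := Additive.toMul x' with hx
  have hxm : Ψ (Additive.ofMul x) = m := by rw [hx, ofMul_toMul]; exact hx'
  refine ⟨x, hxm, fun h hh hht ↦ ?_, ?_⟩
  · -- `h ∈ H_∞ ∩ Stab(t)`
    set u' : (AlgebraicClosure (v.adicCompletion ℚ))ˣ :=
      Units.mk0 (h • (x : AlgebraicClosure (v.adicCompletion ℚ))) ((smul_ne_zero_iff_ne h).mpr x.ne_zero) with hu'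
    have h1 := hequiv h x u' rfl
    rw [if_pos hht, one_zsmul, hxm, hm h hh] at h1
    -- `Ψ x = Ψ (h x)`: `h x = Q^j x`
    rw [← hxm, tatePsi_eq_iff v hker] at h1
    obtain ⟨j, hj⟩ := h1
    have hj' : h • (x : AlgebraicClosure (v.adicCompletion ℚ)) = Q ^ (-j) * x := by
      rw [zpow_neg, ← Units.val_mk0 ((smul_ne_zero_iff_ne h).mpr x.ne_zero), ← hu', hj]
      field_simp
    exact smul_eq_self_of_smul_eq_zpow_mul v (hQfix h) hQ0 hQtor x.ne_zero hj'
  · -- the flip `τ₀`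
    set u' : (AlgebraicClosure (v.adicCompletion ℚ))ˣ :=
      Units.mk0 (τ₀ • (x : AlgebraicClosure (v.adicCompletion ℚ))) ((smul_ne_zero_iff_ne τ₀).mpr x.ne_zero) with hu'
    have h1 := hequiv τ₀ x u' rfl
    rw [if_neg (fun h' ↦ hne (hτ₀t.symm.trans h')), neg_one_zsmul, hxm, hm τ₀ hτ₀] at h1
    -- `Ψ x = -Ψ (τ₀ x)`: `Ψ (τ₀x · x) = 0`
    have h2 : Ψ (Additive.ofMul (u' * x)) = 0 := by rw [ofMul_mul, map_add, hxm, h1, add_neg_cancel]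
    obtain ⟨a, ha⟩ := (hker _).mp h2
    exact ⟨a, by rw [← ha, Units.val_mul, hu', Units.val_mk0]⟩

/-- **`Ψ(T) ⊆ M_∞`**: if `x` is fixed by `H_∞ ∩ Stab(t)` and `τ₀x · x = Q^a`, then `Ψ(x)` is fixed by `H_∞` (an element
of `H_∞` either fixes `t`, or flips it and then acts on `x` like `τ₀`: `hΨ(x) = −Ψ(τ₀x) = −Ψ(Q^a/x) = Ψ(x)`).
[cite: GreenbergLNM1716, §3 (pp. 87–93)] [cite: SilvermanATAEC1994, Lemma V.5.2 (c), Thm. V.5.3] -/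
theorem apply_mem_fixedPoints
    (hker : ∀ u : (AlgebraicClosure (v.adicCompletion ℚ))ˣ, Ψ (Additive.ofMul u) = 0 ↔
      ∃ j : ℤ, (u : AlgebraicClosure (v.adicCompletion ℚ)) = Q ^ j)
    (hequiv : ∀ (σ : absoluteGaloisGroup (v.adicCompletion ℚ)) (u u' : (AlgebraicClosure (v.adicCompletion ℚ))ˣ),
      (u' : AlgebraicClosure (v.adicCompletion ℚ)) = σ • (u : AlgebraicClosure (v.adicCompletion ℚ)) →
        σ • Ψ (Additive.ofMul u) = (if σ • t = t then (1 : ℤ) else -1) • Ψ (Additive.ofMul u'))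
    (ht : ∀ σ : absoluteGaloisGroup (v.adicCompletion ℚ), σ • t = t ∨ σ • t = -t) (hne : -t ≠ t)
    (hτ₀ : τ₀ ∈ localSubgroup κ.kerSubgroup (v.adicCompletion ℚ)) (hτ₀t : τ₀ • t = -t)
    {x : (AlgebraicClosure (v.adicCompletion ℚ))ˣ}
    (hxL : ∀ h ∈ localSubgroup κ.kerSubgroup (v.adicCompletion ℚ), h • t = t →
      h • (x : AlgebraicClosure (v.adicCompletion ℚ)) = x)
    {a : ℤ} (hxa : τ₀ • (x : AlgebraicClosure (v.adicCompletion ℚ)) * x = Q ^ a) :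
    ∀ h ∈ localSubgroup κ.kerSubgroup (v.adicCompletion ℚ), h • Ψ (Additive.ofMul x) = Ψ (Additive.ofMul x) := by
  intro h hh
  rcases ht h with hht | hht
  · have h1 := hequiv h x x (hxL h hh hht).symm
    rw [if_pos hht, one_zsmul] at h1
    exact h1
  · set u' : (AlgebraicClosure (v.adicCompletion ℚ))ˣ :=
      Units.mk0 (h • (x : AlgebraicClosure (v.adicCompletion ℚ))) ((smul_ne_zero_iff_ne h).mpr x.ne_zero) with hu'
    have h1 := hequiv h x u' rfl
    rw [if_neg (fun h' ↦ hne (hht.symm.trans h')), neg_one_zsmul] at h1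
    -- `h x = τ₀ x = Q^a x⁻¹`, so `Ψ (h x) = Ψ (x⁻¹) = -Ψ x`
    have h2 : Ψ (Additive.ofMul u') = Ψ (Additive.ofMul x⁻¹) := by
      rw [tatePsi_eq_iff v hker]
      refine ⟨a, ?_⟩
      rw [hu', Units.val_mk0, Units.val_inv_eq_inv_val, flip_smul_eq hτ₀ hτ₀t hh hht hxL, ← hxa]
      field_simp
    rw [h1, h2, ofMul_inv, map_neg, neg_neg]

end Transport

end Literature.NumberTheory.EllipticCurves.Greenberg1999.MultTowerNS2

end Part3

/-!
## Part 4 — port of `Summits/BirchSwinnertonDyer/BirchSwinnertonDyer/Theorems/ByReductionTypeAtTwoMultTowerNS2TorsionEmbedding.lean`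

# Route `ByReductionTypeAtTwo`, crux `MultUpperHalfAtTwo` (item stmt-BirchSwinnertonDyer-19922), TOWER road, the
# «ONE BIT AT A NON-SPLIT 2» rows: KERNEL BRICK 11 — the `m`-torsion of the local tower kernel `𝒦_{E,n}[p^∞]` embeds
# into the `m`-torsion of the coinvariants `M_∞/(g − 1)M_∞` (local inflation–restriction, torsion-level count)

HONEST FRAMING (cell `bsd-2adic`, run/shared/lean/pub/bsd-2adic/, seat `bsd-2adic-tower-1` GEN 8, HUMAN RULINGS
D-0036 / D-0054 / D-0074): TOOL theorems only (no definition, no named fact, no `sorry`); closes nothing by itself;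
nothing booked; BSD is not proved by any of this. Step S2 of the KERNELISATION of the displayed MEMO binder
`MultTowerNS2.localTowerKerTwoTorsion_le_two_nonsplitTwo_of_tateUnit` (scope HOME/tower/SCOPE-hNS2one-kernel-GEN8.md): the
tree's `WeierstrassCurve.finite_localTowerKerPrimary_and_card_le` (`IwasawaSelmerControlLocalInputsProofs.lean`; Greenberg,
LNM 1716, §3, proofs of Lemmas 3.3/3.4: "`ker(r_{v_n}) ≅ H¹(Γ_{v_n}, ·) ≅ (·)/(γ_{v_n} − 1)(·)`") bounds the ORDER of
`𝒦_{E,n}[p^∞]` by that of the `p`-primary part of the coinvariants; the binder hNS2one is a statement about the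
`2`-TORSION `𝒦_{v,n}[2]`, so this file records the same inflation–restriction embedding
(`ResKernel.exists_addMonoidHom_subgroupResKer_injective`, an injective additive map `ker res ↪ M^N/(γ−1)M^N`) at the
level of `m`-torsion: for any `g ∈ H_{E,n}` generating `H_{E,n}` topologically together with `H_{E,∞}`
(`ZpExtension.exists_mem_localSubgroup_generate`),

  `#{x ∈ 𝒦_{E,n}[p^∞] : m x = 0} ≤ #{y ∈ M_∞/(g − 1)M_∞ : m y = 0}`

whenever the right side is finite (`M_∞ = E(K̄_E)^{H_{E,∞}}`). With `m = 2`, `E = ℚ_v`, `v ∋ 2`, this reduces hNS2one to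
«the coinvariants `E(ℚ_{2,∞})/(g − 1)` of the twisted Tate module have at most two `2`-torsion classes» (scope S3–S6).

* `finite_torsionBy_localTowerKerPrimary_and_card_le` — the statement (any `K`-field `E`, any `ℤ_p`-extension `κ`, any `m`).

References: R. Greenberg, LNM 1716 (1999), §3 Lemma 3.1 (p. 86), Lemmas 3.3–3.4 (pp. 87–89); J.-P. Serre, *Galois
Cohomology*, I §2.6, XIII §1; scope memo SCOPE-hNS2one-kernel-GEN8.md S2.
-/

section Part4

set_option autoImplicit false

open scoped _root_.Classical

universe u

namespace Literature.NumberTheory.EllipticCurves.Greenberg1999.MultTowerNS2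

open _root_.Literature.NumberTheory.EllipticCurves _root_.Literature.NumberTheory.GaloisRepresentations
  _root_.Literature.NumberTheory.EllipticCurves.ResKernel _root_.WeierstrassCurve

variable {K : Type u} [Field K] (W : WeierstrassCurve K) {p : ℕ} [Fact p.Prime] (κ : ZpExtension K p)
  (E : Type u) [Field E] [Algebra K E]

/-- **Local inflation–restriction at the level of `m`-torsion: `𝒦_{E,n}[p^∞][m] ↪ (M_∞/(g − 1)M_∞)[m]`.** Let
`M_∞ = E(K̄_E)^{H_{E,∞}}` and `g ∈ H_{E,n}` generate `H_{E,n}` topologically together with `H_{E,∞}` (every open subgroup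
of `Γ_E` containing both contains `H_{E,n}`; `ZpExtension.exists_mem_localSubgroup_generate`). Then for every `m` the
elements of the `p`-power torsion `𝒦_{E,n}[p^∞]` of the local tower kernel killed by `m` are finitely many, at most as many
as the elements of the coinvariants `M_∞/(g − 1)M_∞` killed by `m`, whenever the latter are finitely many. Proof: the
tree's injective additive inflation–restriction map `ker res ↪ M^N/(γ − 1)M^N`
(`ResKernel.exists_addMonoidHom_subgroupResKer_injective`) for the topological group `H_{E,n}`, its normal subgroup
`H_{E,∞}` and `g`, transported exactly as in `WeierstrassCurve.finite_localTowerKerPrimary_and_card_le` (whose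
`p`-primary count this refines to `m`-torsion). [cite: GreenbergLNM1716, §3 Lemma 3.3 (proof, p. 87)] -/
theorem finite_torsionBy_localTowerKerPrimary_and_card_le (n : ℕ) {g : Field.absoluteGaloisGroup E}
    (hg : g ∈ localSubgroup (κ.layerSubgroup n) E)
    (hgen : ∀ U : Subgroup (Field.absoluteGaloisGroup E),
      IsOpen (U : Set (Field.absoluteGaloisGroup E)) → localSubgroup κ.kerSubgroup E ≤ U →
        g ∈ U → localSubgroup (κ.layerSubgroup n) E ≤ U) (m : ℕ)
    [Finite {y : FixedPoints.addSubgroup (localSubgroup κ.kerSubgroup E) (localPoints W E) ⧸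
        (subOne (localSubgroup κ.kerSubgroup E) (localPoints W E) g).range // m • y = 0}] :
    Finite {x : W.localTowerKerPrimary κ E n // m • x = 0} ∧
      Nat.card {x : W.localTowerKerPrimary κ E n // m • x = 0} ≤
        Nat.card {y : FixedPoints.addSubgroup (localSubgroup κ.kerSubgroup E) (localPoints W E) ⧸
          (subOne (localSubgroup κ.kerSubgroup E) (localPoints W E) g).range // m • y = 0} := by
  -- notation
  let P : Type u := localPoints W E
  let Hn : Subgroup (Field.absoluteGaloisGroup E) := localSubgroup (κ.layerSubgroup n) E
  let Hi : Subgroup (Field.absoluteGaloisGroup E) := localSubgroup κ.kerSubgroup E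
  let N : Subgroup Hn := Hi.subgroupOf Hn
  let γ : Hn := ⟨g, hg⟩
  have hle : Hi ≤ Hn := localSubgroup_ker_le_layer κ E n
  -- (1) `H_{E,∞}` and `g` generate `H_{E,n}` (inside the topological group `H_{E,n}`)
  have hgen' : ∀ U : Subgroup Hn, IsOpen (U : Set Hn) → N ≤ U → γ ∈ U → U = ⊤ := by
    intro U hU hNU hγU
    let U' : Subgroup (Field.absoluteGaloisGroup E) := U.map Hn.subtype
    have hopen : IsOpen (U' : Set (Field.absoluteGaloisGroup E)) :=
      (isOpen_localSubgroup_layerSubgroup E κ n).isOpenMap_subtype_val _ hU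
    have hN' : Hi ≤ U' := fun τ hτ ↦
      ⟨⟨τ, hle hτ⟩, hNU (Subgroup.mem_subgroupOf.mpr hτ), rfl⟩
    have hγU' : g ∈ U' := ⟨γ, hγU, rfl⟩
    have hle' := hgen U' hopen hN' hγU'
    rw [eq_top_iff]
    intro x _
    obtain ⟨u, hu, hux⟩ := hle' x.2
    have : u = x := Subtype.ext hux
    exact this ▸ hu
  -- (2) orbit maps on `H_{E,n}` are continuous
  have hcont : ∀ m : P, Continuous fun x : Hn ↦ x • m := fun m ↦
    (continuous_smul_localPoints W E m).comp continuous_subtype_val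
  -- (3) `P^N = P^{H_{E,∞}} = M_∞`, compatibly with `g - 1`
  have hfix : FixedPoints.addSubgroup N P = FixedPoints.addSubgroup Hi P := by
    ext m
    simp only [FixedPoints.mem_addSubgroup]
    constructor
    · intro h τ
      exact h ⟨⟨τ, hle τ.2⟩, Subgroup.mem_subgroupOf.mpr τ.2⟩
    · intro h x
      exact h ⟨((x : Hn) : Field.absoluteGaloisGroup E), Subgroup.mem_subgroupOf.mp x.2⟩
  let e : FixedPoints.addSubgroup N P ≃+ FixedPoints.addSubgroup Hi P :=
    AddEquiv.addSubgroupCongr hfix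
  have he : AddSubgroup.map (e : FixedPoints.addSubgroup N P →+ FixedPoints.addSubgroup Hi P)
      (subOne N P γ).range = (subOne Hi P g).range := by
    ext b
    constructor
    · rintro ⟨x, ⟨y, rfl⟩, rfl⟩
      exact ⟨e y, Subtype.ext rfl⟩
    · rintro ⟨y, rfl⟩
      exact ⟨subOne N P γ (e.symm y), ⟨e.symm y, rfl⟩, Subtype.ext rfl⟩
  let eq : FixedPoints.addSubgroup N P ⧸ (subOne N P γ).range ≃+
      FixedPoints.addSubgroup Hi P ⧸ (subOne Hi P g).range :=
    QuotientAddGroup.congr _ _ e he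
  -- (4) the generic INJECTIVE additive embedding on `H_{E,n}`
  obtain ⟨w, hw, -⟩ := exists_addMonoidHom_subgroupResKer_injective N P γ hgen' hcont
  -- (5) `𝒦_{E,n} ⊆ ker (res : H¹(H_{E,n}, P) → H¹(N, P))`
  have hker : W.localTowerKer κ E n ≤ subgroupResKer P N := by
    intro c hc
    let j : N →ₜ* Hi :=
      { toFun := fun x ↦ ⟨((x : Hn) : Field.absoluteGaloisGroup E), Subgroup.mem_subgroupOf.mp x.2⟩
        map_one' := rfl
        map_mul' := fun _ _ ↦ rfl
        continuous_toFun :=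
          (continuous_subtype_val.comp continuous_subtype_val).subtype_mk _ }
    have hcomp : (resH1Hom j (AddMonoidHom.id P) (fun _ _ ↦ rfl)).comp
        (Literature.NumberTheory.EllipticCurves.resOfLe P hle) = resSubgroup N P := by
      unfold Literature.NumberTheory.EllipticCurves.resOfLe ResKernel.resSubgroup
      rw [resH1Hom_comp]
      exact resH1Hom_congr (ContinuousMonoidHom.ext fun _ ↦ rfl) (AddMonoidHom.ext fun _ ↦ rfl) _ _
    rw [mem_subgroupResKer_iff, ← hcomp, AddMonoidHom.comp_apply,
      (W.mem_localTowerKer_iff κ E n c).mp hc, map_zero]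
  -- (6) the map `𝒦_{E,n}[p^∞][m] → (M_∞/(g-1)M_∞)[m]`, `c ↦ eq (w c)`, and its injectivity
  let ι : W.localTowerKerPrimary κ E n →+ subgroupResKer P N :=
    { toFun := fun c ↦ ⟨(c : discreteH1 Hn P), hker c.2.1⟩
      map_zero' := rfl
      map_add' := fun _ _ ↦ rfl }
  have hι : Function.Injective ι := fun a b hab ↦ by
    have h1 := congrArg (fun z : subgroupResKer P N ↦ (z : discreteH1 Hn P)) hab
    exact Subtype.ext h1
  let F : W.localTowerKerPrimary κ E n →+ FixedPoints.addSubgroup Hi P ⧸ (subOne Hi P g).range :=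
    (eq.toAddMonoidHom.comp w).comp ι
  have hF : Function.Injective F := eq.injective.comp (hw.comp hι)
  let f : {x : W.localTowerKerPrimary κ E n // m • x = 0} →
      {y : FixedPoints.addSubgroup Hi P ⧸ (subOne Hi P g).range // m • y = 0} :=
    fun x ↦ ⟨F x.1, by rw [← map_nsmul, x.2, map_zero]⟩
  have hf : Function.Injective f := fun a b hab ↦
    Subtype.ext (hF (Subtype.ext_iff.mp hab))
  exact ⟨Finite.of_injective f hf, Nat.card_le_card_of_injective f hf⟩

end Literature.NumberTheory.EllipticCurves.Greenberg1999.MultTowerNS2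

end Part4

/-!
## Part 5 — port of `Summits/BirchSwinnertonDyer/BirchSwinnertonDyer/Theorems/ByReductionTypeAtTwoMultTowerSplitOneBitHolds.lean`

# Route `ByReductionTypeAtTwo`, crux `MultUpperHalfAtTwo` (item stmt-BirchSwinnertonDyer-19922), TOWER road, the
# «ONE BIT AT A SPLIT MULTIPLICATIVE PRIME» rows: KERNEL PROOF of the PRINT binder `hSP1`
# (`Greenberg1999.sec3_natCard_pTorsion_localTowerKerPrimary_le_splitMultiplicative_rat`, Greenberg LNM 1716 §3 pp. 91–92)

HONEST FRAMING (cell `bsd-2adic`, run/shared/lean/pub/bsd-2adic/, seat `bsd-2adic-tower-1` GEN 10, HUMAN RULINGS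
D-0036 / D-0054 / D-0074): theorems only (no definition, no named fact, no `sorry`); this file PROVES the displayed
PRINT binder `hSP1` of the split one-bit tower doors (`…MultUpperHalfTowerSplitOneBit.lean`, seat bsd-2adic-mult GEN 12;
cell memo HOME/mult/NOTE-SP1ONE.md, whose §5 is the road taken here) as a kernel theorem, for EVERY prime `p` as the
named fact is stated; it closes no item by itself (the binder is a HYPOTHESIS of split tower class files of item 19922,
whose other hypotheses stay displayed); nothing booked; BSD is not proved by any of this.

THE PROOF (Greenberg, LNM 1716, §3, pp. 91–92 "`ker(r_{v_n}) ⊆ ker(d_{v_n}) ≅ ℚ_p/ℤ_p`", made explicit on the Tate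
module). For `W/ℚ` globally minimal, SPLIT multiplicative at `p`, `κ` cyclotomic, `v ∋ p`, `n`:
* BRICK 11 (`MultTowerNS2.finite_torsionBy_localTowerKerPrimary_and_card_le`): `𝒦_{v,n}[p^∞][p] ↪ (M_∞/(g−1)M_∞)[p]`,
  `M_∞ = E(K̄_v)^{H_∞}`, `g ∈ H_n` a topological generator of `H_n` mod `H_∞` (`κ(res g) = p^n·unit`,
  `MultTowerSP1.exists_units_kappa_resGal_eq_of_generate`);
* Tate's SPLIT uniformisation `Φ : K̄_vˣ → E(K̄_v)` (`TateCurve.Silverman1994_thmV53_tateUniformisation_holds`, a tree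
  THEOREM: onto, kernel `q^ℤ`, `Γ_{ℚ_v}`-equivariant) identifies `M_∞` with `Φ(L_∞ˣ)`, `L_∞ = K̄_v^{H_∞}`
  (`exists_unit_of_mem_fixedPoints`: a preimage of an `H_∞`-fixed point is `H_∞`-fixed, by the orbit-finiteness lemma
  `MultTowerNS2.smul_eq_self_of_smul_eq_zpow_mul`), so a `p`-torsion class is `[Φ x]` with `x^p = q^j · gz/z`, `x, z ∈ L_∞ˣ`;
* two classes with `j ≡ j' (mod p)` coincide: `y = (x/x')q^c` (`pc = j' − j`) has `y^p = gζ/ζ` (`ζ = z/z'`), hence at a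
  finite level `F_{n+R} ∋ y, ζ` (`MultTowerSP1.exists_forall_mem_localSubgroup_layerSubgroup_smul_eq`) the orbit product
  `N_R(y) = ∏_{i<p^R} g^i y` has `N_R(y)^p = N_R(gζ)/N_R(ζ) = 1` and so `N_{R+1}(y) = N_R(y)^p = 1`; by the cyclic
  Hilbert 90 one layer up (`MultTowerSP1.exists_eq_smul_div_of_prod_smul_eq_one`) `y = gw/w` with `w ∈ F_{n+R+1}ˣ ⊆ L_∞ˣ`,
  i.e. `Φ(x) − Φ(x') = (g − 1)Φ(w) ∈ (g − 1)M_∞`;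
* pigeonhole: among any `p + 1` classes of `(M_∞/(g−1)M_∞)[p]` two coincide, so that `p`-torsion is finite of order `≤ p`,
  and so is `𝒦_{v,n}[p^∞][p]`.

* `exists_unit_of_mem_fixedPoints` — `E(K̄_v)^N ⊆ Φ((K̄_v^N)ˣ)` for any subgroup `N ≤ Γ_{ℚ_v}` (split transport);
* `sec3_natCard_pTorsion_localTowerKerPrimary_le_splitMultiplicative_rat_holds` — the binder, proved (type = the Literature
  `Prop` verbatim).

References: R. Greenberg, LNM 1716 (1999), §3 pp. 85–93 (esp. pp. 91–92); J. Silverman, GTM 151, Thm. V.3.1, Thm. V.5.3;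
J. Neukirch, *ANT* IV (3.5) (Hilbert 90); cell memo NOTE-SP1ONE.md §5.
-/

section Part5

set_option autoImplicit false

open scoped _root_.Classical

namespace Literature.NumberTheory.EllipticCurves.Greenberg1999.MultTowerSP1

open _root_.NumberField _root_.IsDedekindDomain _root_.Field _root_.WeierstrassCurve _root_.PadicInt _root_.Rat.HeightOneSpectrum
  _root_.Literature.NumberTheory.EllipticCurves _root_.Literature.NumberTheory.EllipticCurves.ResKernel
  _root_.Literature.NumberTheory.GaloisRepresentations

/-! ### Transport along the SPLIT Tate uniformisation: `E(K̄_v)^N = Φ((K̄_v^N)ˣ)` -/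

/-- **`E(K̄_v)^N ⊆ Φ((K̄_v^N)ˣ)`** for the split (honestly `Γ`-equivariant) Tate uniformisation `Φ` with kernel `q^ℤ`
and any subgroup `N ≤ Γ_{ℚ_v}`: a point fixed by `N` is `Φ(x)` with `x` fixed by `N`. For `h ∈ N`:
`Φ(x) = hΦ(x) = Φ(hx)`, so `hx = q^j x`, and `hx = x` by orbit finiteness (`MultTowerNS2.smul_eq_self_of_smul_eq_zpow_mul`).
[cite: GreenbergLNM1716, §3 (pp. 90–92)] [cite: SilvermanATAEC1994, Thm. V.3.1 (c),(d), Thm. V.5.3] -/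
theorem exists_unit_of_mem_fixedPoints (v : HeightOneSpectrum (𝓞 ℚ)) {W : WeierstrassCurve ℚ}
    {Φ : Additive (AlgebraicClosure (v.adicCompletion ℚ))ˣ →+ localPoints W (v.adicCompletion ℚ)}
    {Q : AlgebraicClosure (v.adicCompletion ℚ)} (hsurj : Function.Surjective Φ)
    (hker : ∀ u : (AlgebraicClosure (v.adicCompletion ℚ))ˣ, Φ (Additive.ofMul u) = 0 ↔
      ∃ j : ℤ, (u : AlgebraicClosure (v.adicCompletion ℚ)) = Q ^ j)
    (hequiv : ∀ (σ : absoluteGaloisGroup (v.adicCompletion ℚ)) (u u' : (AlgebraicClosure (v.adicCompletion ℚ))ˣ),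
      (u' : AlgebraicClosure (v.adicCompletion ℚ)) = σ • (u : AlgebraicClosure (v.adicCompletion ℚ)) →
        σ • Φ (Additive.ofMul u) = Φ (Additive.ofMul u'))
    (hQfix : ∀ σ : absoluteGaloisGroup (v.adicCompletion ℚ), σ • Q = Q) (hQ0 : Q ≠ 0)
    (hQtor : ∀ j : ℤ, Q ^ j = 1 → j = 0) (N : Subgroup (absoluteGaloisGroup (v.adicCompletion ℚ)))
    {m : localPoints W (v.adicCompletion ℚ)} (hm : ∀ h ∈ N, h • m = m) :
    ∃ x : (AlgebraicClosure (v.adicCompletion ℚ))ˣ, Φ (Additive.ofMul x) = m ∧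
      ∀ h ∈ N, h • (x : AlgebraicClosure (v.adicCompletion ℚ)) = x := by
  obtain ⟨x', hx'⟩ := hsurj m
  set x : (AlgebraicClosure (v.adicCompletion ℚ))ˣ := Additive.toMul x' with hx
  have hxm : Φ (Additive.ofMul x) = m := by rw [hx, ofMul_toMul]; exact hx'
  refine ⟨x, hxm, fun h hh ↦ ?_⟩
  set u' : (AlgebraicClosure (v.adicCompletion ℚ))ˣ :=
    Units.mk0 (h • (x : AlgebraicClosure (v.adicCompletion ℚ))) ((smul_ne_zero_iff_ne h).mpr x.ne_zero) with hu'
  have h1 := hequiv h x u' rfl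
  rw [hxm, hm h hh, ← hxm, MultTowerNS2.tatePsi_eq_iff v hker] at h1
  obtain ⟨j, hj⟩ := h1
  have hj' : h • (x : AlgebraicClosure (v.adicCompletion ℚ)) = Q ^ (-j) * x := by
    rw [zpow_neg, ← Units.val_mk0 ((smul_ne_zero_iff_ne h).mpr x.ne_zero), ← hu', hj]
    field_simp
  exact MultTowerNS2.smul_eq_self_of_smul_eq_zpow_mul v (hQfix h) hQ0 hQtor x.ne_zero hj'

/-! ### The binder -/

/-- Transport of `HasSplitMultiplicativeReductionAtPrime` along an equality of primes (the `Fact` instances are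
propositionally irrelevant). [folklore] -/
private theorem hasSplitMultiplicativeReductionAtPrime_congr (W : WeierstrassCurve ℚ) {q q' : ℕ} (h : q = q')
    [Fact q.Prime] [Fact q'.Prime] :
    W.HasSplitMultiplicativeReductionAtPrime q ↔ W.HasSplitMultiplicativeReductionAtPrime q' := by
  subst h; exact Iff.rfl

/-- **«One bit at a split multiplicative prime» — KERNEL PROOF of the PRINT binder `hSP1` (Greenberg, LNM 1716, §3,
pp. 91–92: at a SPLIT `v ∣ p`, `ker(r_{v_n})` is a subgroup of `ker(d_{v_n}) ≅ ℚ_p/ℤ_p`, so its `p`-torsion has at most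
`p` elements).** For a globally minimal `W/ℚ` with split multiplicative reduction at the prime `p`, every cyclotomic
`ℤ_p`-datum `κ`, the place `v ∋ p` and every layer `n`, the `p`-torsion of the local tower kernel `𝒦_{v,n}[p^∞]` is
finite of order at most `p`. Proof: BRICK 11 embeds it into the `p`-torsion of `M_∞/(g−1)M_∞`; Tate's split
uniformisation identifies `M_∞` with `Φ(L_∞ˣ)` (`exists_unit_of_mem_fixedPoints`); a `p`-torsion class `[Φ x]` has
`x^p = q^j gz/z`, and two classes with the same `j mod p` coincide by the orbit-product computation
`N_{R+1}((x/x')q^c) = 1` at a finite level and the cyclic Hilbert 90 one layer up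
(`MultTowerSP1.exists_eq_smul_div_of_prod_smul_eq_one`); pigeonhole over `p + 1` classes.
[cite: GreenbergLNM1716, §3, between Prop. 3.6 and Prop. 3.7 (PDF pp. 91–92)]
[cite: SilvermanATAEC1994, Thm. V.3.1 (c),(d), Thm. V.5.3] [cite: NeukirchANT1999, Ch. IV (3.5)] -/
theorem sec3_natCard_pTorsion_localTowerKerPrimary_le_splitMultiplicative_rat_of_tateUniformisation :
    Greenberg1999.sec3_natCard_pTorsion_localTowerKerPrimary_le_splitMultiplicative_rat := by
  intro W _ _ p _ hsplit κ hκ v hv n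
  -- the groups `H_∞ ≤ H_m`
  have hile : ∀ m : ℕ, localSubgroup κ.kerSubgroup (v.adicCompletion ℚ) ≤
      localSubgroup (κ.layerSubgroup m) (v.adicCompletion ℚ) := fun m ↦ localSubgroup_ker_le_layer κ _ m
  -- S0: split multiplicative reduction at the place `v`
  haveI hfact : Fact (Nat.Prime (primesEquiv v : ℕ)) := ⟨(primesEquiv v).2⟩
  have hpv : ((primesEquiv v : Nat.Primes) : ℕ) = p := primesEquiv_eq_of_natCast_mem v Fact.out hv
  have hsplitv : W.HasSplitMultiplicativeReductionAt v :=
    (hasSplitMultiplicativeReductionAtPrime_iff_hasSplitMultiplicativeReductionAt W v).mp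
      ((hasSplitMultiplicativeReductionAtPrime_congr W hpv).mpr hsplit)
  -- Tate's split uniformisation at `v`
  obtain ⟨q, Φ, hq0, hqv, hsurj, hker, hequiv, -⟩ :=
    TateCurve.Silverman1994_thmV53_tateUniformisation_holds W v hsplitv
  set Q : AlgebraicClosure (v.adicCompletion ℚ) :=
    algebraMap (v.adicCompletion ℚ) (AlgebraicClosure (v.adicCompletion ℚ)) q with hQ
  have hQ0 : Q ≠ 0 := by rw [hQ]; exact (map_ne_zero _).mpr hq0
  have hQfix : ∀ σ : absoluteGaloisGroup (v.adicCompletion ℚ), σ • Q = Q := fun σ ↦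
    AlgEquiv.commutes (absoluteGaloisGroup.toAlgEquiv _ σ) q
  have hQtor : ∀ j : ℤ, Q ^ j = 1 → j = 0 := by
    intro j hj
    have hj' : q ^ j = 1 := by
      apply (algebraMap (v.adicCompletion ℚ) (AlgebraicClosure (v.adicCompletion ℚ))).injective
      rw [map_zpow₀, map_one]; exact hj
    have hq1 : ‖q‖ < 1 := Valued.toNormedField.norm_lt_one_iff.mpr hqv
    have hpow : ∀ m : ℕ, q ^ m = 1 → m = 0 := fun m hm ↦ by
      by_contra hm0
      have h1 : ‖q‖ ^ m < 1 := pow_lt_one₀ (norm_nonneg q) hq1 hm0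
      rw [← norm_pow, hm, norm_one] at h1
      exact lt_irrefl _ h1
    cases j with
    | ofNat m =>
      rw [Int.ofNat_eq_natCast, zpow_natCast] at hj'
      rw [Int.ofNat_eq_natCast, hpow m hj']
      rfl
    | negSucc m =>
      rw [zpow_negSucc, inv_eq_one] at hj'
      exact absurd (hpow (m + 1) hj') (Nat.succ_ne_zero m)
  -- equivariance in value form
  have hequiv' : ∀ (σ : absoluteGaloisGroup (v.adicCompletion ℚ)) (w w' : (AlgebraicClosure (v.adicCompletion ℚ))ˣ),
      (w' : AlgebraicClosure (v.adicCompletion ℚ)) = σ • (w : AlgebraicClosure (v.adicCompletion ℚ)) →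
        σ • Φ (Additive.ofMul w) = Φ (Additive.ofMul w') := by
    intro σ w w' h
    have hw' : w' = Units.map (absoluteGaloisGroup.toAlgEquiv (v.adicCompletion ℚ) σ :
        AlgebraicClosure (v.adicCompletion ℚ) →* AlgebraicClosure (v.adicCompletion ℚ)) w := Units.ext h
    rw [hw']
    exact hequiv σ w
  -- a topological generator `g ∈ H_n` of `H_n` modulo `H_∞`, `κ(res g) = p^n · unit`
  obtain ⟨g, hgn, hgen⟩ := ZpExtension.exists_mem_localSubgroup_generate κ (v.adicCompletion ℚ) n
  obtain ⟨ug, hug⟩ := exists_units_kappa_resGal_eq_of_generate hκ v hv n hgn hgen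
  have hgR : ∀ R : ℕ, g ^ p ^ R ∈ localSubgroup (κ.layerSubgroup (n + R)) (v.adicCompletion ℚ) := fun R ↦
    (pow_mem_localSubgroup_layerSubgroup_iff (κ := κ) v n R hug _).mpr dvd_rfl
  -- the coinvariants `M_∞/(g-1)M_∞`
  set P := localPoints W (v.adicCompletion ℚ) with hP
  set M : AddSubgroup P :=
    FixedPoints.addSubgroup (localSubgroup κ.kerSubgroup (v.adicCompletion ℚ)) P with hM
  have memM : ∀ {a : P}, a ∈ M ↔ ∀ h ∈ localSubgroup κ.kerSubgroup (v.adicCompletion ℚ), h • a = a := fun {a} ↦ by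
    rw [hM, FixedPoints.mem_addSubgroup]
    exact ⟨fun H h hh ↦ H ⟨h, hh⟩, fun H h ↦ H h h.2⟩
  set d : M →+ M := subOne (localSubgroup κ.kerSubgroup (v.adicCompletion ℚ)) P g with hd
  -- `Φ` of an `H_∞`-fixed unit lies in `M_∞`
  have hΦM : ∀ x : (AlgebraicClosure (v.adicCompletion ℚ))ˣ,
      (∀ h ∈ localSubgroup κ.kerSubgroup (v.adicCompletion ℚ), h • (x : AlgebraicClosure (v.adicCompletion ℚ)) = x) →
        Φ (Additive.ofMul x) ∈ M := fun x hx ↦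
    memM.mpr fun h hh ↦ hequiv' h x x (hx h hh).symm
  -- every `p`-torsion class has a representative `Φ x`, `x ∈ L_∞ˣ`, with `x^p = Q^j · gz/z`, `z ∈ L_∞ˣ`
  have hrep : ∀ y : {y : M ⧸ d.range // p • y = 0},
      ∃ (x z : (AlgebraicClosure (v.adicCompletion ℚ))ˣ) (j : ℤ) (m : M),
        (m : M ⧸ d.range) = y.1 ∧ (m : P) = Φ (Additive.ofMul x) ∧
        (∀ h ∈ localSubgroup κ.kerSubgroup (v.adicCompletion ℚ),
          h • (x : AlgebraicClosure (v.adicCompletion ℚ)) = x) ∧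
        (∀ h ∈ localSubgroup κ.kerSubgroup (v.adicCompletion ℚ),
          h • (z : AlgebraicClosure (v.adicCompletion ℚ)) = z) ∧
        (x : AlgebraicClosure (v.adicCompletion ℚ)) ^ p =
          Q ^ j * (g • (z : AlgebraicClosure (v.adicCompletion ℚ)) / z) := by
    rintro ⟨y, hy⟩
    obtain ⟨m, rfl⟩ := QuotientAddGroup.mk_surjective y
    obtain ⟨x, hxm, hxL⟩ := exists_unit_of_mem_fixedPoints v hsurj hker hequiv' hQfix hQ0 hQtor _ (memM.mp m.2)
    -- `p m ∈ (g-1) M_∞`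
    have hpm : (p • m : M) ∈ d.range := by
      rw [← QuotientAddGroup.eq_zero_iff]
      exact hy
    obtain ⟨w, hw⟩ := hpm
    obtain ⟨z, hzm, hzL⟩ := exists_unit_of_mem_fixedPoints v hsurj hker hequiv' hQfix hQ0 hQtor _ (memM.mp w.2)
    -- `Φ (x^p) = Φ (gz / z)`
    set gz : (AlgebraicClosure (v.adicCompletion ℚ))ˣ :=
      Units.mk0 (g • (z : AlgebraicClosure (v.adicCompletion ℚ))) ((smul_ne_zero_iff_ne g).mpr z.ne_zero) with hgz
    have hgΦ : g • Φ (Additive.ofMul z) = Φ (Additive.ofMul gz) := hequiv' g z gz rfl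
    have h3 : Φ (Additive.ofMul (x ^ p)) = Φ (Additive.ofMul (gz * z⁻¹)) := by
      rw [ofMul_pow, map_nsmul, hxm, ofMul_mul, ofMul_inv, map_add, map_neg, ← hgΦ, hzm, ← sub_eq_add_neg]
      have h4 := congrArg (fun b : M ↦ (b : P)) hw
      simp only [hd, AddSubgroupClass.coe_nsmul] at h4
      exact h4.symm
    rw [MultTowerNS2.tatePsi_eq_iff v hker] at h3
    obtain ⟨j, hj⟩ := h3
    refine ⟨x, z, j, m, rfl, hxm.symm, hxL, hzL, ?_⟩
    rw [Units.val_pow_eq_pow_val] at hj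
    rw [hj, Units.val_mul, Units.val_inv_eq_inv_val, hgz, Units.val_mk0, div_eq_mul_inv]
  choose x z j m hmy hmx hxL hzL hxp using hrep
  -- among `p + 1` `p`-torsion classes two coincide
  have keyp : ∀ ys : Fin (p + 1) → {y : M ⧸ d.range // p • y = 0}, ∃ i i' : Fin (p + 1), i ≠ i' ∧ ys i = ys i' := by
    intro ys
    -- pigeonhole on `j mod p`
    obtain ⟨i, i', hii', hjj⟩ := Fintype.exists_ne_map_eq_of_card_lt
      (fun i : Fin (p + 1) ↦ ((j (ys i) : ℤ) : ZMod p)) (by rw [ZMod.card, Fintype.card_fin]; omega)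
    refine ⟨i, i', hii', ?_⟩
    obtain ⟨c, hc⟩ := (ZMod.intCast_eq_intCast_iff_dvd_sub _ _ _).mp hjj
    -- `σ (a / b) = σ a / σ b` on `K̄_v`
    have hsdiv : ∀ (σ : absoluteGaloisGroup (v.adicCompletion ℚ)) (a b : AlgebraicClosure (v.adicCompletion ℚ)),
        σ • (a / b) = σ • a / σ • b := fun σ a b ↦ by
      rw [div_eq_mul_inv, smul_mul', smul_inv'', div_eq_mul_inv]
    have hx0 : ∀ k, (x (ys k) : AlgebraicClosure (v.adicCompletion ℚ)) ≠ 0 := fun k ↦ (x (ys k)).ne_zero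
    have hz0 : ∀ k, (z (ys k) : AlgebraicClosure (v.adicCompletion ℚ)) ≠ 0 := fun k ↦ (z (ys k)).ne_zero
    -- `y = (x_i / x_i') Q^c` and `ζ = z_i / z_i'`, with `y^p = gζ/ζ`
    set yy : AlgebraicClosure (v.adicCompletion ℚ) :=
      (x (ys i) : AlgebraicClosure (v.adicCompletion ℚ)) / (x (ys i')) * Q ^ c with hyy
    set ζ : AlgebraicClosure (v.adicCompletion ℚ) :=
      (z (ys i) : AlgebraicClosure (v.adicCompletion ℚ)) / (z (ys i')) with hζ
    have hζ0 : ζ ≠ 0 := div_ne_zero (hz0 i) (hz0 i')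
    have hyL : ∀ h ∈ localSubgroup κ.kerSubgroup (v.adicCompletion ℚ), h • yy = yy := fun h hh ↦ by
      rw [hyy, smul_mul', hsdiv, smul_zpow₀', hxL _ h hh, hxL _ h hh, hQfix]
    have hζL : ∀ h ∈ localSubgroup κ.kerSubgroup (v.adicCompletion ℚ), h • ζ = ζ := fun h hh ↦ by
      rw [hζ, hsdiv, hzL _ h hh, hzL _ h hh]
    have hyp : yy ^ p = g • ζ / ζ := by
      have e1 := hxp (ys i)
      have e2 := hxp (ys i')
      have hgz0 : g • (z (ys i') : AlgebraicClosure (v.adicCompletion ℚ)) ≠ 0 :=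
        (smul_ne_zero_iff_ne g).mpr (hz0 i')
      rw [hyy, hζ, mul_pow, div_pow, e1, e2, hsdiv, ← zpow_natCast (Q ^ c) p, ← zpow_mul,
        show j (ys i') = j (ys i) + (p : ℤ) * c by linear_combination hc]
      rw [zpow_add₀ hQ0, mul_comm (p : ℤ) c]
      field_simp
    -- a finite level `F_{n+R} ∋ y, ζ`
    obtain ⟨my, hmy'⟩ := exists_forall_mem_localSubgroup_layerSubgroup_smul_eq (κ := κ) v yy hyL
    obtain ⟨mz, hmz'⟩ := exists_forall_mem_localSubgroup_layerSubgroup_smul_eq (κ := κ) v ζ hζL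
    set R : ℕ := my + mz with hR
    have hyR : ∀ h ∈ localSubgroup (κ.layerSubgroup (n + R)) (v.adicCompletion ℚ), h • yy = yy := fun h hh ↦
      hmy' h (localSubgroup_layerSubgroup_antitone κ (v.adicCompletion ℚ) (by omega) hh)
    have hζR : ∀ h ∈ localSubgroup (κ.layerSubgroup (n + R)) (v.adicCompletion ℚ), h • ζ = ζ := fun h hh ↦
      hmz' h (localSubgroup_layerSubgroup_antitone κ (v.adicCompletion ℚ) (by omega) hh)
    have hgRy : (g ^ p ^ R) • yy = yy := hyR _ (hgR R)
    have hgRζ : (g ^ p ^ R) • ζ = ζ := hζR _ (hgR R)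
    -- orbit products: `N_R(y)^p = 1`, hence `N_{R+1}(y) = 1`
    have hNζ0 : (∏ k ∈ Finset.range (p ^ R), (g ^ k) • ζ) ≠ 0 :=
      Finset.prod_ne_zero_iff.mpr fun k _ ↦ (smul_ne_zero_iff_ne _).mpr hζ0
    have hNp : (∏ k ∈ Finset.range (p ^ R), (g ^ k) • yy) ^ p = 1 := by
      rw [← prod_smul_pow, hyp, div_eq_mul_inv, MultTowerNS2.prod_smul_mul, MultTowerNS2.prod_smul_inv,
        MultTowerNS2.prod_smul_smul_eq g (p ^ R) hgRζ, mul_inv_cancel₀ hNζ0]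
    have hN1 : (∏ k ∈ Finset.range (p ^ (R + 1)), (g ^ k) • yy) = 1 := by
      rw [pow_succ, prod_smul_range_mul_eq_pow g (p ^ R) hgRy p, hNp]
    -- Hilbert 90 one layer up: `y = gw/w`, `w ∈ F_{n+R+1}ˣ`
    have hyR1 : ∀ h ∈ localSubgroup (κ.layerSubgroup (n + (R + 1))) (v.adicCompletion ℚ), h • yy = yy := fun h hh ↦
      hyR h (localSubgroup_layerSubgroup_antitone κ (v.adicCompletion ℚ) (by omega) hh)
    obtain ⟨w, hw0, hwL, hyw⟩ := exists_eq_smul_div_of_prod_smul_eq_one (κ := κ) v n (R + 1) hug hyR1 hN1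
    -- `Φ (x i) - Φ (x i') = (g - 1) Φ(w)` with `Φ w ∈ M_∞`
    set wu : (AlgebraicClosure (v.adicCompletion ℚ))ˣ := Units.mk0 w hw0 with hwu
    have hwM : Φ (Additive.ofMul wu) ∈ M := hΦM wu fun h hh ↦ by
      rw [hwu, Units.val_mk0]; exact hwL h (hile _ hh)
    set gw : (AlgebraicClosure (v.adicCompletion ℚ))ˣ := Units.mk0 (g • w) ((smul_ne_zero_iff_ne g).mpr hw0) with hgw
    have hgΦ : g • Φ (Additive.ofMul wu) = Φ (Additive.ofMul gw) :=
      hequiv' g wu gw (by rw [hgw, hwu, Units.val_mk0, Units.val_mk0])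
    have hdP : (d ⟨Φ (Additive.ofMul wu), hwM⟩ : P) = g • Φ (Additive.ofMul wu) - Φ (Additive.ofMul wu) := rfl
    have hdiff : Φ (Additive.ofMul (x (ys i))) - Φ (Additive.ofMul (x (ys i'))) =
        (d ⟨Φ (Additive.ofMul wu), hwM⟩ : P) := by
      rw [hdP, hgΦ]
      have e1 : Φ (Additive.ofMul (x (ys i))) - Φ (Additive.ofMul (x (ys i'))) =
          Φ (Additive.ofMul (x (ys i) * (x (ys i'))⁻¹)) := by
        rw [ofMul_mul, ofMul_inv, map_add, map_neg, sub_eq_add_neg]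
      have e2 : Φ (Additive.ofMul gw) - Φ (Additive.ofMul wu) = Φ (Additive.ofMul (gw * wu⁻¹)) := by
        rw [ofMul_mul, ofMul_inv, map_add, map_neg, sub_eq_add_neg]
      rw [e1, e2, MultTowerNS2.tatePsi_eq_iff v hker]
      refine ⟨-c, ?_⟩
      rw [Units.val_mul, Units.val_inv_eq_inv_val, Units.val_mul, Units.val_inv_eq_inv_val, hgw, hwu, Units.val_mk0,
        Units.val_mk0, ← div_eq_mul_inv, ← div_eq_mul_inv, ← hyw, hyy, zpow_neg]
      field_simp
    have hmm : (m (ys i) : M ⧸ d.range) = m (ys i') := by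
      rw [QuotientAddGroup.eq_iff_sub_mem]
      refine ⟨⟨Φ (Additive.ofMul wu), hwM⟩, Subtype.ext ?_⟩
      rw [AddSubgroupClass.coe_sub, hmx, hmx]
      exact hdiff.symm
    exact Subtype.ext (by rw [← hmy (ys i), ← hmy (ys i'), hmm])
  -- hence the `p`-torsion of the coinvariants is finite of order `≤ p`
  haveI hfin : Finite {y : M ⧸ d.range // p • y = 0} := by
    by_contra hinf
    rw [not_finite_iff_infinite] at hinf
    let emb := Infinite.natEmbedding {y : M ⧸ d.range // p • y = 0}
    obtain ⟨i, i', hii', h⟩ := keyp (fun i : Fin (p + 1) ↦ emb i)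
    exact hii' (Fin.ext (emb.injective h))
  have hcard : Nat.card {y : M ⧸ d.range // p • y = 0} ≤ p := by
    by_contra hlt
    push Not at hlt
    letI := Fintype.ofFinite {y : M ⧸ d.range // p • y = 0}
    rw [Nat.card_eq_fintype_card] at hlt
    let emb : Fin (p + 1) ↪ {y : M ⧸ d.range // p • y = 0} :=
      (Fin.castLEEmb hlt).trans (Fintype.equivFin _).symm.toEmbedding
    obtain ⟨i, i', hii', h⟩ := keyp emb
    exact hii' (emb.injective h)
  -- BRICK 11
  have h11 := MultTowerNS2.finite_torsionBy_localTowerKerPrimary_and_card_le W κ (v.adicCompletion ℚ) n hgn hgen p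
  exact ⟨h11.1, h11.2.trans hcard⟩

end Literature.NumberTheory.EllipticCurves.Greenberg1999.MultTowerSP1

end Part5

/-! ## Part 6 — the EXACT discharge(s) -/

/-- **Greenberg 1999, §3 pp. 91–92 HOLDS** — the named fact
`Literature.NumberTheory.EllipticCurves.Greenberg1999.sec3_natCard_pTorsion_localTowerKerPrimary_le_splitMultiplicative_rat` under its
discharge name of record: for `W/ℚ` globally minimal and SPLIT multiplicative at `p`, `κ` the cyclotomic character, `v ∋ p` and every
layer `n`, the `p`-torsion of the `p`-primary part of the local tower kernel `𝒦_{v,n}` is finite of order `≤ p` («`ker(r_{v_n}) ⊆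
ker(d_{v_n}) ≅ ℚ_p/ℤ_p`») — Part 5's `MultTowerSP1.sec3_natCard_pTorsion_localTowerKerPrimary_le_splitMultiplicative_rat_of_tateUniformisation`
(Tate's split uniformisation + the twisted Tate algebra + cyclic Hilbert 90 + pigeonhole).  Summits-side twin:
`Summit.BirchSwinnertonDyer.BirchSwinnertonDyer.Theorems.MultTowerSP1.sec3_natCard_pTorsion_localTowerKerPrimary_le_splitMultiplicative_rat_holds`.
[cite: GreenbergLNM1716, §3 pp. 91–92] [cite: SilvermanATAEC1994, Thm. V.5.3] -/
theorem Literature.NumberTheory.EllipticCurves.Greenberg1999.sec3_natCard_pTorsion_localTowerKerPrimary_le_splitMultiplicative_rat_holds :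
    Literature.NumberTheory.EllipticCurves.Greenberg1999.sec3_natCard_pTorsion_localTowerKerPrimary_le_splitMultiplicative_rat :=
  Literature.NumberTheory.EllipticCurves.Greenberg1999.MultTowerSP1.sec3_natCard_pTorsion_localTowerKerPrimary_le_splitMultiplicative_rat_of_tateUniformisation

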